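import Literature.Barriers.ABC.BakerMethodBoundsKummerArchProofs
import HarnessLib

/-!
# Proofs for `BakerMethodBounds`, VII: the symmetric form of the Kummer-conditional archimedean
# input (the shape of Cijsouw–Waldschmidt 1977, Proposition 1)

`Literature/Barriers/ABC/BakerMethodBoundsKummerArchSymmProofs.lean` — sequel to
`BakerMethodBoundsKummerArchProofs.lean` (file VI); theorems only (no definition, no named fact).

File VI proved `BakerMethodBounds` (= Stewart–Yu 2001, Theorem 1, `log c ≤ κ R^{1/3} (log R)³`)
from Yu's `p`-adic theorem over `ℚ` and the hypothesis `hW₂`: a lower bound, with ANY constant, for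
linear forms in logarithms of positive rationals `α₀, …, αₙ` satisfying the `2`-Kummer condition
`[ℚ(√α₀, …, √αₙ) : ℚ] = 2^{n+1}`, of the shape of Waldschmidt 1980, Prop. 3.8 at `E = 2`:
`|Λ| > exp{−Cw(n+1) V₀⋯Vₙ (W + log(2Vₙ)) log(2V⁺ₙ₋₁) (log 2)^{-(n+2)}}` — the largest `V` in the
first logarithmic factor, the SECOND largest in the second.

Here the second factor is weakened to the largest `V` as well (`hW₃`:
`|Λ| > exp{−Cw(n+1) V₀⋯Vₙ (W + log(2Vₙ)) log(2Vₙ) (log 2)^{-(n+2)}}`; `hW₂ ⇒ hW₃` is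
`kummerArchBound_last_of_two`), which is the shape of

> P. L. Cijsouw, M. Waldschmidt, *Linear forms and simultaneous approximations*, Compositio Math.
> 34 (1977), **Proposition 1** (p. 183): for `α₁, …, αₙ` non-zero algebraic in a number field `K`
> of degree `≤ D`, `Aⱼ ≥ max(6, H(αⱼ), e^{|log αⱼ|})`, `β₀, …, βₙ₋₁ ∈ K` of heights `≤ B` (`≥ 6`),
> `Λ₀ = β₀ + β₁ log α₁ + ⋯ + βₙ₋₁ log αₙ₋₁ − log αₙ`, `Ω = (log A₁)⋯(log Aₙ)`, and a prime
> `p ≤ p₀` with `[K(α₁^{1/p}, …, αₙ^{1/p}) : K] = pⁿ`: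
> `|Λ₀| > exp{−C₁(n, D, p₀) Ω log Ω (log B + log Ω)}`

(over `ℚ` with `p = 2`: `Ω ≤ 2.8^{n+1} ∏ Vⱼ`, `log Ω ≤ 1.5 (n+1) log(2Vₙ)`, `log B ≤ W + log 6`), whose
proof (pp. 183–191) is Baker's method with a `2`-descent and ONE Schwarz lemma per step — "there is
no need to increase the number of zeros, and we therefore avoid the induction in the extrapolation
argument … we can deal with an arbitrary prime `p`, even with `p = 2`" (p. 174) — and a short
endgame (all `Lⱼ` vanish; a polynomial with too many zeros): about half the length of Waldschmidt's
1980 §3, with no parameter `E`. So along this route the archimedean input of the Stewart–Yu bound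
is that proposition for `K = ℚ`, `p = 2`, `β₀ = 0` (`BakerMethodBounds_of_yu_kummerArchBound₃`).

The price is paid in the second regime only: in the branch with generators `{q large} ∪ {β₀}` the
last factor is now `log(2H)`, `H = max(h(β₀), Λ) ≤ Λ(1 + 6KJ²τY)`, bounded by `DΛY`
(`regimeIIK_logs`) instead of `log(2Λ) ≤ 2Λ`: `log c ≤ M₀ R^{7/24} Λ⁶ Y³` with `Y³` for `Y²`
(`log_le_of_sq_lt_kummer₃`), absorbed by `7/24 < 1/3` as before (`le_of_le_mul_log_max_cube`,
`regimeII_endgame9`).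

## Contents

* `kummerArchBound_last_of_two` (`hW₂ ⇒ hW₃`), `kummer_arch_lower_bound₃`,
  `kummer_arch_lower_bound_primes₃` (the bound applied to `{p ∈ L} ∪ {β₀}` / to primes only);
* `regimeIIK_arith₃`, `log_le_of_sq_lt_kummer₃` (second regime, `Λ⁶ Y³`);
* `le_of_le_mul_log_max_cube`, `regimeII_endgame9`,
  `bakerShapeBound_third_three_of_padicClause_kummerArchBound₃` and the adapters
  `BakerMethodBounds_of_padicClause_kummerArchBound₃`, `BakerMethodBounds_of_thm328Finite_kummerArchBound₃`,
  `BakerMethodBounds_of_yu_kummerArchBound₃`, `BakerMethodBounds_of_padicBound_kummerArchBound₃`,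
  `stewart_yu_of_yu_kummerArchBound₃`.

## References

* [CijsouwWaldschmidt1977] P. L. Cijsouw, M. Waldschmidt, *Linear forms and simultaneous
  approximations*, Compositio Math. 34 (1977), no. 2, 173–197 (numdam CM_1977__34_2_173_0) —
  Theorem 1 (p. 173), p. 174, Proposition 1 (p. 183), its proof §4 (pp. 183–191), §6 (p. 196).
* [Waldschmidt1980] M. Waldschmidt, *A lower bound for linear forms in logarithms*, Acta Arith. 37
  (1980), 257–283 — Prop. 3.8 (p. 274); p. 259 (the comparison with [CijsouwWaldschmidt1977]).
* [StewartYu2001] C. L. Stewart, K. Yu, *On the abc conjecture, II*, Duke Math. J. 108 (2001),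
  169–181 — Theorem 1.
* [EvertseGyory2015] J.-H. Evertse, K. Győry, *Unit Equations in Diophantine Number Theory*,
  CUP 2015 — Thm 3.2.7, Thm 3.2.8 (p. 62).
-/

noncomputable section

open Finset Real Height Polynomial IntermediateField
open Literature.NumberTheory.DiophantineGeometry
open Literature.NumberTheory.DiophantineGeometry.Dioph
open Literature.NumberTheory.DiophantineGeometry.Pasten

namespace Literature.Barriers.ABC

/-! ### The symmetric form, and the archimedean bound applied to few generators -/

section KummerArchSymm

variable (Cw : ℕ → ℝ)

/-- **The symmetric `E = 2` form implies nothing new; conversely the `E = 2` form `hW₂` implies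
the SYMMETRIC form `hW₃`** in which Waldschmidt's second logarithmic factor `log(2V⁺ₙ₋₁)`
(second-largest `V`) is weakened to `log(2Vₙ)` (largest `V`): `V⁺ₙ₋₁ ≤ Vₙ` by monotonicity
(`V⁺ₙ₋₁ = 1 ≤ V₀` for a single logarithm). The symmetric form is the shape of Cijsouw–Waldschmidt
1977, Proposition 1 (`|Λ₀| > exp{−C₁ Ω log Ω (log B + log Ω)}`, `Ω = ∏ log Aⱼ`).
[cite: Waldschmidt1980, Prop 3.8 (p. 274)] [cite: CijsouwWaldschmidt1977, Prop 1 (p. 183)] -/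
theorem kummerArchBound_last_of_two (hCw : ∀ n, 0 ≤ Cw n)
    (hW₂ : ∀ (n : ℕ) (α : Fin (n + 1) → ℚ) (b : Fin (n + 1) → ℤ) (V : Fin (n + 1) → ℝ) (W : ℝ),
      (∀ j, 0 < α j ∧ α j ≠ 1) →
      Module.finrank ℚ ↥(IntermediateField.adjoin ℚ
          (Set.range fun j => Real.sqrt (α j : ℝ))) = 2 ^ (n + 1) →
      Monotone V → 1 ≤ V 0 →
      (∀ j, max (logHeight₁ (α j)) |Real.log (α j : ℝ)| ≤ V j) →
      0 < W → (∀ j, logHeight₁ (b j : ℚ) ≤ W) →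
      ∑ j, (b j : ℝ) * Real.log (α j : ℝ) ≠ 0 →
      Real.exp (-(Cw (n + 1) * (∏ j, V j) * (W + Real.log (2 * V (Fin.last n))) *
          Real.log (2 * (if n = 0 then 1 else V ⟨n - 1, by omega⟩)) / Real.log 2 ^ (n + 2))) <
        |∑ j, (b j : ℝ) * Real.log (α j : ℝ)|) :
    ∀ (n : ℕ) (α : Fin (n + 1) → ℚ) (b : Fin (n + 1) → ℤ) (V : Fin (n + 1) → ℝ) (W : ℝ),
      (∀ j, 0 < α j ∧ α j ≠ 1) →
      Module.finrank ℚ ↥(IntermediateField.adjoin ℚ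
          (Set.range fun j => Real.sqrt (α j : ℝ))) = 2 ^ (n + 1) →
      Monotone V → 1 ≤ V 0 →
      (∀ j, max (logHeight₁ (α j)) |Real.log (α j : ℝ)| ≤ V j) →
      0 < W → (∀ j, logHeight₁ (b j : ℚ) ≤ W) →
      ∑ j, (b j : ℝ) * Real.log (α j : ℝ) ≠ 0 →
      Real.exp (-(Cw (n + 1) * (∏ j, V j) * (W + Real.log (2 * V (Fin.last n))) *
          Real.log (2 * V (Fin.last n)) / Real.log 2 ^ (n + 2))) <
        |∑ j, (b j : ℝ) * Real.log (α j : ℝ)| := by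
  intro n α b V W hαpos hKum hmono hV0 hVj hW0 hWb hΛ
  have key := hW₂ n α b V W hαpos hKum hmono hV0 hVj hW0 hWb hΛ
  refine lt_of_le_of_lt (Real.exp_le_exp.mpr (neg_le_neg ?_)) key
  have hV1 : ∀ j, 1 ≤ V j := fun j => hV0.trans (hmono (Fin.zero_le j))
  have hsec1 : 1 ≤ (if n = 0 then (1 : ℝ) else V ⟨n - 1, by omega⟩) := by
    split_ifs
    · exact le_rfl
    · exact hV1 _
  have hsec : (if n = 0 then (1 : ℝ) else V ⟨n - 1, by omega⟩) ≤ V (Fin.last n) := by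
    split_ifs
    · exact hV1 _
    · exact hmono (Fin.le_last _)
  have hfac : Real.log (2 * (if n = 0 then (1 : ℝ) else V ⟨n - 1, by omega⟩)) ≤
      Real.log (2 * V (Fin.last n)) := Real.log_le_log (by linarith) (by linarith)
  have hprod : 0 ≤ ∏ j, V j := Finset.prod_nonneg fun j _ => by linarith [hV1 j]
  have hWl : 0 ≤ W + Real.log (2 * V (Fin.last n)) := by
    have : 0 ≤ Real.log (2 * V (Fin.last n)) := Real.log_nonneg (by linarith [hV1 (Fin.last n)])
    linarith
  have hlog2 : 0 < Real.log 2 := Real.log_pos one_lt_two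
  apply div_le_div_of_nonneg_right _ (by positivity)
  exact mul_le_mul_of_nonneg_left hfac (mul_nonneg (mul_nonneg (hCw _) hprod) hWl)

/-- **The archimedean bound for `Λ = m log β₀ + ∑_{p ∈ L} e_p log p` under the `2`-Kummer
condition, from the SYMMETRIC form `hW₃`** (largest `V` in both logarithmic factors): with the
data of `kummer_arch_lower_bound₂`,
`log |Λ| > −Cw(#L+1) · Λ₁^{#L} H · (log(eB) + log(2H)) · log(2H) / (log 2)^{#L+2}`,
`H = max(h(β₀), Λ₁)`. [cite: CijsouwWaldschmidt1977, Prop 1 (p. 183)]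
[cite: Waldschmidt1980, Prop 3.8 (p. 274)] -/
theorem kummer_arch_lower_bound₃
    (hW₃ : ∀ (n : ℕ) (α : Fin (n + 1) → ℚ) (b : Fin (n + 1) → ℤ) (V : Fin (n + 1) → ℝ) (W : ℝ),
      (∀ j, 0 < α j ∧ α j ≠ 1) →
      Module.finrank ℚ ↥(IntermediateField.adjoin ℚ
          (Set.range fun j => Real.sqrt (α j : ℝ))) = 2 ^ (n + 1) →
      Monotone V → 1 ≤ V 0 →
      (∀ j, max (logHeight₁ (α j)) |Real.log (α j : ℝ)| ≤ V j) →
      0 < W → (∀ j, logHeight₁ (b j : ℚ) ≤ W) →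
      ∑ j, (b j : ℝ) * Real.log (α j : ℝ) ≠ 0 →
      Real.exp (-(Cw (n + 1) * (∏ j, V j) * (W + Real.log (2 * V (Fin.last n))) *
          Real.log (2 * V (Fin.last n)) / Real.log 2 ^ (n + 2))) <
        |∑ j, (b j : ℝ) * Real.log (α j : ℝ)|)
    (L : Finset ℕ) (hL : ∀ p ∈ L, p.Prime) (e : ℕ → ℤ)
    {β₀ : ℚ} (hβ0 : 0 < β₀) (hβ1 : β₀ ≠ 1) (hβsq : ¬ IsSquare β₀)
    (hν : ∀ p ∈ L, padicValRat p β₀ = 0) (m : ℤ)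
    {Λ₁ : ℝ} (hΛ₁ : 1 ≤ Λ₁) (hΛL : ∀ p ∈ L, Real.log p ≤ Λ₁)
    {B : ℝ} (hB1 : 1 ≤ B) (hBe : ∀ p ∈ L, (|e p| : ℝ) ≤ B) (hBm : (|m| : ℝ) ≤ B)
    (hΛ : (m : ℝ) * Real.log (β₀ : ℝ) + ∑ p ∈ L, (e p : ℝ) * Real.log p ≠ 0) :
    -(Cw (L.card + 1) * (Λ₁ ^ L.card * max (logHeight₁ β₀) Λ₁) *
        (Real.log (Real.exp 1 * B) + Real.log (2 * max (logHeight₁ β₀) Λ₁)) *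
        Real.log (2 * max (logHeight₁ β₀) Λ₁) / Real.log 2 ^ (L.card + 2)) <
      Real.log |(m : ℝ) * Real.log (β₀ : ℝ) + ∑ p ∈ L, (e p : ℝ) * Real.log p| := by
  classical
  set k : ℕ := L.card with hk
  set pr : Fin k → ℕ := fun i => L.orderEmbOfFin hk.symm i with hpr
  have hprL : ∀ i, pr i ∈ L := fun i => L.orderEmbOfFin_mem hk.symm i
  have hprp : ∀ i, (pr i).Prime := fun i => hL _ (hprL i)
  have hinj : Function.Injective pr := (L.orderEmbOfFin hk.symm).injective
  set α : Fin (k + 1) → ℚ := Fin.snoc (fun i => (pr i : ℚ)) β₀ with hα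
  set b : Fin (k + 1) → ℤ := Fin.snoc (fun i => e (pr i)) m with hb
  set H : ℝ := max (logHeight₁ β₀) Λ₁ with hH
  set V : Fin (k + 1) → ℝ := Fin.snoc (fun _ => Λ₁) H with hV
  set W : ℝ := Real.log (Real.exp 1 * B) with hWdef
  have hHΛ : Λ₁ ≤ H := le_max_right _ _
  have hH1 : 1 ≤ H := hΛ₁.trans hHΛ
  have he2 : (2 : ℝ) ≤ Real.exp 1 := by have := Real.add_one_le_exp (1 : ℝ); linarith
  -- hypotheses of `hW₃`
  have hαpos : ∀ j, 0 < α j ∧ α j ≠ 1 := by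
    intro j
    rcases Fin.eq_castSucc_or_eq_last j with ⟨i, rfl⟩ | rfl
    · simp only [hα, Fin.snoc_castSucc]
      exact ⟨by exact_mod_cast (hprp i).pos, by exact_mod_cast (hprp i).one_lt.ne'⟩
    · simp only [hα, Fin.snoc_last]; exact ⟨hβ0, hβ1⟩
  have hKum : Module.finrank ℚ ↥(IntermediateField.adjoin ℚ
      (Set.range fun j => Real.sqrt (α j : ℝ))) = 2 ^ (k + 1) :=
    finrank_adjoin_sqrt_eq_two_pow α (fun j => (hαpos j).1.le)
      (not_isSquare_prod_snoc pr hprp hinj hβ0.ne' hβsq fun i => hν _ (hprL i))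
  have hmono : Monotone V := by
    intro i j hij
    rcases Fin.eq_castSucc_or_eq_last j with ⟨j', rfl⟩ | rfl
    · rcases Fin.eq_castSucc_or_eq_last i with ⟨i', rfl⟩ | rfl
      · simp only [hV, Fin.snoc_castSucc]; exact le_rfl
      · exact absurd hij (not_le.mpr (Fin.castSucc_lt_last j'))
    · rcases Fin.eq_castSucc_or_eq_last i with ⟨i', rfl⟩ | rfl
      · simp only [hV, Fin.snoc_castSucc, Fin.snoc_last]; exact hHΛ
      · exact le_rfl
  have hVge : ∀ j, Λ₁ ≤ V j := by
    intro j
    rcases Fin.eq_castSucc_or_eq_last j with ⟨i, rfl⟩ | rfl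
    · simp only [hV, Fin.snoc_castSucc]; exact le_rfl
    · simp only [hV, Fin.snoc_last]; exact hHΛ
  have hV0 : 1 ≤ V 0 := hΛ₁.trans (hVge 0)
  have hVj : ∀ j, max (logHeight₁ (α j)) |Real.log (α j : ℝ)| ≤ V j := by
    intro j
    rcases Fin.eq_castSucc_or_eq_last j with ⟨i, rfl⟩ | rfl
    · simp only [hα, hV, Fin.snoc_castSucc]
      have hp := hprp i
      haveI : NeZero (pr i) := ⟨hp.ne_zero⟩
      have hlog0 : 0 ≤ Real.log (pr i : ℝ) := Real.log_nonneg (by exact_mod_cast hp.one_lt.le)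
      rw [Rat.logHeight₁_natCast, Rat.cast_natCast, abs_of_nonneg hlog0, max_self]
      exact hΛL _ (hprL i)
    · simp only [hα, hV, Fin.snoc_last]
      refine max_le (le_max_left _ _) ?_
      have h := abs_log_abs_le_logHeight₁ hβ0.ne'
      rw [abs_of_pos (show (0 : ℝ) < ((β₀ : ℚ) : ℝ) by exact_mod_cast hβ0)] at h
      exact h.trans (le_max_left _ _)
  have hW1 : 1 ≤ W := by
    rw [hWdef, Real.log_mul (Real.exp_pos 1).ne' (by linarith), Real.log_exp]
    linarith [Real.log_nonneg hB1]
  have hW0 : 0 < W := by linarith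
  have hWb : ∀ j, logHeight₁ (b j : ℚ) ≤ W := by
    intro j
    have hbj : (|(b j : ℝ)|) ≤ B := by
      rcases Fin.eq_castSucc_or_eq_last j with ⟨i, rfl⟩ | rfl
      · simp only [hb, Fin.snoc_castSucc]; exact hBe _ (hprL i)
      · simp only [hb, Fin.snoc_last]; exact hBm
    rw [logHeight₁_intCast_eq, hWdef]
    apply Real.log_le_log (by positivity)
    calc max (|(b j : ℝ)|) 1 ≤ B := max_le hbj hB1
      _ = 1 * B := (one_mul B).symm
      _ ≤ Real.exp 1 * B := by gcongr; linarith
  have hsum : ∑ j, (b j : ℝ) * Real.log (α j : ℝ) =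
      (m : ℝ) * Real.log (β₀ : ℝ) + ∑ p ∈ L, (e p : ℝ) * Real.log p := by
    rw [Fin.sum_univ_castSucc]
    simp only [hα, hb, Fin.snoc_castSucc, Fin.snoc_last, Rat.cast_natCast]
    rw [add_comm]
    congr 1
    have himg : Finset.image pr Finset.univ = L := by
      rw [hpr]; exact Finset.image_orderEmbOfFin_univ L hk.symm
    rw [← Finset.sum_image (f := fun p : ℕ => (e p : ℝ) * Real.log p)
      (fun i _ j _ h => hinj h), himg]
  have hprodV : ∏ j, V j = Λ₁ ^ k * H := by
    rw [Fin.prod_univ_castSucc]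
    simp only [hV, Fin.snoc_castSucc, Fin.snoc_last, Finset.prod_const, Finset.card_univ,
      Fintype.card_fin]
  -- apply the hypothesis
  have key := hW₃ k α b V W hαpos hKum hmono hV0 hVj hW0 hWb (by rw [hsum]; exact hΛ)
  rw [hsum, hprodV] at key
  have hlast : V (Fin.last k) = H := by simp only [hV, Fin.snoc_last]
  rw [hlast] at key
  have hpos : 0 < |(m : ℝ) * Real.log (β₀ : ℝ) + ∑ p ∈ L, (e p : ℝ) * Real.log p| :=
    abs_pos.mpr hΛ
  rw [Real.lt_log_iff_exp_lt hpos]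
  exact key

/-- **The same for `Λ = ∑_{p ∈ L} e_p log p` (no `β₀`), from the symmetric form `hW₃`**: here
`H = Λ₁` and the bound is that of `kummer_arch_lower_bound_primes₂` verbatim,
`log |Λ| > −Cw(#L) · Λ₁^{#L} · (log(eB) + log(2Λ₁)) · log(2Λ₁) / (log 2)^{#L+1}`.
[cite: CijsouwWaldschmidt1977, Prop 1 (p. 183)] [cite: Waldschmidt1980, Prop 3.8 (p. 274)] -/
theorem kummer_arch_lower_bound_primes₃
    (hW₃ : ∀ (n : ℕ) (α : Fin (n + 1) → ℚ) (b : Fin (n + 1) → ℤ) (V : Fin (n + 1) → ℝ) (W : ℝ),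
      (∀ j, 0 < α j ∧ α j ≠ 1) →
      Module.finrank ℚ ↥(IntermediateField.adjoin ℚ
          (Set.range fun j => Real.sqrt (α j : ℝ))) = 2 ^ (n + 1) →
      Monotone V → 1 ≤ V 0 →
      (∀ j, max (logHeight₁ (α j)) |Real.log (α j : ℝ)| ≤ V j) →
      0 < W → (∀ j, logHeight₁ (b j : ℚ) ≤ W) →
      ∑ j, (b j : ℝ) * Real.log (α j : ℝ) ≠ 0 →
      Real.exp (-(Cw (n + 1) * (∏ j, V j) * (W + Real.log (2 * V (Fin.last n))) *
          Real.log (2 * V (Fin.last n)) / Real.log 2 ^ (n + 2))) <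
        |∑ j, (b j : ℝ) * Real.log (α j : ℝ)|)
    (L : Finset ℕ) (hL : ∀ p ∈ L, p.Prime) (hL1 : 1 ≤ L.card) (e : ℕ → ℤ)
    {Λ₁ : ℝ} (hΛ₁ : 1 ≤ Λ₁) (hΛL : ∀ p ∈ L, Real.log p ≤ Λ₁)
    {B : ℝ} (hB1 : 1 ≤ B) (hBe : ∀ p ∈ L, (|e p| : ℝ) ≤ B)
    (hΛ : ∑ p ∈ L, (e p : ℝ) * Real.log p ≠ 0) :
    -(Cw L.card * Λ₁ ^ L.card * (Real.log (Real.exp 1 * B) + Real.log (2 * Λ₁)) *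
        Real.log (2 * Λ₁) / Real.log 2 ^ (L.card + 1)) <
      Real.log |∑ p ∈ L, (e p : ℝ) * Real.log p| := by
  classical
  -- split off one prime `p₁` of `L` and use the previous lemma with `β₀ := p₁`
  -- (a prime is not a square in `ℚ` and is a unit at the other primes)
  obtain ⟨p₁, hp₁L⟩ : L.Nonempty := Finset.card_pos.mp hL1
  set L' : Finset ℕ := L.erase p₁ with hL'
  have hp₁ : p₁.Prime := hL _ hp₁L
  have hL'sub : L' ⊆ L := Finset.erase_subset _ _
  have hL'prime : ∀ p ∈ L', p.Prime := fun p hp => hL p (hL'sub hp)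
  have hcard : L'.card + 1 = L.card := by
    rw [hL', Finset.card_erase_of_mem hp₁L]; omega
  have hβ0 : (0 : ℚ) < (p₁ : ℚ) := by exact_mod_cast hp₁.pos
  have hβ1 : (p₁ : ℚ) ≠ 1 := by exact_mod_cast hp₁.one_lt.ne'
  have hβsq : ¬ IsSquare ((p₁ : ℕ) : ℚ) := not_isSquare_ratCast_prime hp₁
  have hν : ∀ p ∈ L', padicValRat p (p₁ : ℚ) = 0 := by
    intro p hp
    have hpp : p.Prime := hL'prime p hp
    have hne : p ≠ p₁ := Finset.ne_of_mem_erase hp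
    haveI : Fact p.Prime := ⟨hpp⟩
    haveI : Fact p₁.Prime := ⟨hp₁⟩
    rw [padicValRat.of_nat, padicValNat_primes hne, Nat.cast_zero]
  have hsplit : ∑ p ∈ L, (e p : ℝ) * Real.log p =
      (e p₁ : ℝ) * Real.log ((p₁ : ℚ) : ℝ) + ∑ p ∈ L', (e p : ℝ) * Real.log p := by
    rw [Rat.cast_natCast, hL', ← Finset.add_sum_erase L _ hp₁L]
  have hΛ' : (e p₁ : ℝ) * Real.log ((p₁ : ℚ) : ℝ) + ∑ p ∈ L', (e p : ℝ) * Real.log p ≠ 0 := by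
    rw [← hsplit]; exact hΛ
  have key := kummer_arch_lower_bound₃ Cw hW₃ L' hL'prime e hβ0 hβ1 hβsq hν (e p₁) hΛ₁
    (fun p hp => hΛL p (hL'sub hp)) hB1 (fun p hp => hBe p (hL'sub hp)) (hBe p₁ hp₁L) hΛ'
  rw [← hsplit, hcard] at key
  -- `h(p₁) = log p₁ ≤ Λ₁`, so `max(h(p₁), Λ₁) = Λ₁`
  haveI : NeZero p₁ := ⟨hp₁.ne_zero⟩
  have hmax : max (logHeight₁ (p₁ : ℚ)) Λ₁ = Λ₁ := by
    rw [Rat.logHeight₁_natCast]; exact max_eq_right (hΛL p₁ hp₁L)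
  rw [hmax] at key
  have hpow : Λ₁ ^ L'.card * Λ₁ = Λ₁ ^ L.card := by rw [← hcard, pow_succ]
  have hexp : L'.card + 2 = L.card + 1 := by omega
  rw [hpow, hexp] at key
  convert key using 2

end KummerArchSymm

/-! ### The second regime with the symmetric bound -/

section RegimeTwoKummerSymm

variable {K : ℝ} {a b c : ℕ}

/-- The arithmetic of the second regime for the symmetric archimedean form: the targets of
`regimeIIK_arith` weakened to `1800 (C' D² K J² τ Λ⁶) Y³`, and the fifth one for the bound
`64 C' D² Λ⁶ Hs Y²` of the `β₀`-branch. [folklore] -/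
theorem regimeIIK_arith₃ {C' D K J τ Λ Y Hs : ℝ} (hC' : 1 ≤ C') (hD : 1 ≤ D) (hK : 1 ≤ K)
    (hJ : 1 ≤ J) (hτ : 1 ≤ τ) (hΛ : 1 ≤ Λ) (hY : 1 ≤ Y) (hHs : Hs ≤ 1 + 6 * K * J ^ 2 * τ * Y) :
    1 ≤ C' * D ^ 2 * K * J ^ 2 * τ * Λ ^ 6 ∧
    3 * (K * J ^ 2 * τ) * Y ≤ 1800 * (C' * D ^ 2 * K * J ^ 2 * τ * Λ ^ 6) * Y ^ 3 ∧
    (4 : ℝ) ≤ 1800 * (C' * D ^ 2 * K * J ^ 2 * τ * Λ ^ 6) * Y ^ 3 ∧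
    2 + 2 * (192 * C' * Λ ^ 5 * Y) ≤ 1800 * (C' * D ^ 2 * K * J ^ 2 * τ * Λ ^ 6) * Y ^ 3 ∧
    2 + 2 * (64 * C' * D ^ 2 * Λ ^ 6 * Hs * Y ^ 2) ≤
      1800 * (C' * D ^ 2 * K * J ^ 2 * τ * Λ ^ 6) * Y ^ 3 := by
  obtain ⟨h1, h2, h3, h4, -⟩ := regimeIIK_arith hC' hD hK hJ hτ hΛ hY hHs
  have hJ2 : 1 ≤ J ^ 2 := one_le_pow₀ hJ
  have hΛ6 : 1 ≤ Λ ^ 6 := one_le_pow₀ hΛ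
  have hY3 : 1 ≤ Y ^ 3 := one_le_pow₀ hY
  have hY23 : Y ^ 2 ≤ Y ^ 3 := pow_le_pow_right₀ hY (by norm_num)
  have hKJτ : 1 ≤ K * J ^ 2 * τ := by
    calc (1 : ℝ) = 1 * 1 * 1 := by ring
      _ ≤ K * J ^ 2 * τ := mul_le_mul (mul_le_mul hK hJ2 zero_le_one (by linarith)) hτ zero_le_one
          (by positivity)
  set P : ℝ := C' * D * K * J ^ 2 * τ * Λ ^ 6 with hP
  set P₃ : ℝ := C' * D ^ 2 * K * J ^ 2 * τ * Λ ^ 6 with hP₃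
  have hP0 : 0 ≤ P := zero_le_one.trans h1
  have hPP : P ≤ P₃ := by
    have : P₃ = P * D := by rw [hP, hP₃]; ring
    rw [this]; exact le_mul_of_one_le_right hP0 hD
  have hP1 : 1 ≤ P₃ := h1.trans hPP
  have hmono : 1800 * P * Y ^ 2 ≤ 1800 * P₃ * Y ^ 3 :=
    mul_le_mul (mul_le_mul_of_nonneg_left hPP (by norm_num)) hY23 (by positivity) (by positivity)
  refine ⟨hP1, h2.trans hmono, h3.trans hmono, h4.trans hmono, ?_⟩
  have hb : C' * D ^ 2 * Λ ^ 6 ≤ P₃ := by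
    have : P₃ = (C' * D ^ 2 * Λ ^ 6) * (K * J ^ 2 * τ) := by rw [hP₃]; ring
    rw [this]; exact le_mul_of_one_le_right (by positivity) hKJτ
  have hx : 64 * C' * D ^ 2 * Λ ^ 6 * Hs * Y ^ 2 ≤
      64 * C' * D ^ 2 * Λ ^ 6 * (1 + 6 * K * J ^ 2 * τ * Y) * Y ^ 2 := by
    have : 0 ≤ 64 * C' * D ^ 2 * Λ ^ 6 := by positivity
    exact mul_le_mul_of_nonneg_right (mul_le_mul_of_nonneg_left hHs this) (by positivity)
  have hx2 : 64 * C' * D ^ 2 * Λ ^ 6 * (1 + 6 * K * J ^ 2 * τ * Y) * Y ^ 2 =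
      64 * ((C' * D ^ 2 * Λ ^ 6) * Y ^ 2) + 384 * (P₃ * Y ^ 3) := by rw [hP₃]; ring
  have hx3 : (C' * D ^ 2 * Λ ^ 6) * Y ^ 2 ≤ P₃ * Y ^ 3 :=
    mul_le_mul hb hY23 (by positivity) (by linarith)
  have hPY : 1 ≤ P₃ * Y ^ 3 := one_le_mul_of_one_le_of_one_le hP1 hY3
  nlinarith

set_option maxHeartbeats 1600000 in
/-- **Second regime, Kummer version, from the SYMMETRIC form `hW₃` of the archimedean bound**
(largest `V` in both logarithmic factors — the shape of Cijsouw–Waldschmidt 1977, Prop. 1). For an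
abc triple with `a ≤ b`, `ab > 1` and `a² < c`:
`log c ≤ 1800 C⋆ D² K C₁² · R^{7/24} · Λ⁶ · Y³` (`Λ = max(1, log R)`, `Y = log max{e, 2 log c}`,
`C⋆ = max(1, Cw(2), Cw(3), Cw(4))`, `D = log 6 + log K + 2 log C₁ + 8`). Same proof as
`log_le_of_sq_lt_kummer₂`; the only change is in the branch with generators `{q large} ∪ {β₀}`,
where the last factor is now `log(2H)`, `H = max(h(β₀), Λ) ≤ Λ(1 + 6KJ²τY)`, bounded by `DΛY`
(`regimeIIK_logs`) instead of `log(2Λ) ≤ 2Λ`: one more factor `DY/2`.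
[cite: StewartYu2001, Theorem 1 (proof), as reconstructed]
[cite: CijsouwWaldschmidt1977, Prop 1 (p. 183)] [cite: Waldschmidt1980, Prop 3.8 (p. 274)] -/
theorem log_le_of_sq_lt_kummer₃ (hK : 1 ≤ K)
    (hP2 : ∀ (ι : Type) [Fintype ι], 0 < Fintype.card ι →
      ∀ ξ : ι → ℚ, (∀ i, ξ i ≠ 0 ∧ ξ i ≠ 1 ∧ ξ i ≠ -1) →
      ∀ ζ : ℚ, (ζ = 1 ∨ ζ = -1) → ∀ b : ι → ℤ, ζ * ∏ i, ξ i ^ b i ≠ 1 →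
      ∀ p : ℕ, p.Prime →
        (padicValRat p (1 - ζ * ∏ i, ξ i ^ b i) : ℝ) * Real.log p <
          K ^ Fintype.card ι * (p / Real.log p) *
            Real.log (max (Real.exp 1) (p * logHeight₁ (ζ * ∏ i, ξ i ^ b i))) *
            ∏ i, logHeight₁ (ξ i))
    (Cw : ℕ → ℝ) (hCw : ∀ n, 0 ≤ Cw n)
    (hW₃ : ∀ (n : ℕ) (α : Fin (n + 1) → ℚ) (b : Fin (n + 1) → ℤ) (V : Fin (n + 1) → ℝ) (W : ℝ),
      (∀ j, 0 < α j ∧ α j ≠ 1) →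
      Module.finrank ℚ ↥(IntermediateField.adjoin ℚ
          (Set.range fun j => Real.sqrt (α j : ℝ))) = 2 ^ (n + 1) →
      Monotone V → 1 ≤ V 0 →
      (∀ j, max (logHeight₁ (α j)) |Real.log (α j : ℝ)| ≤ V j) →
      0 < W → (∀ j, logHeight₁ (b j : ℚ) ≤ W) →
      ∑ j, (b j : ℝ) * Real.log (α j : ℝ) ≠ 0 →
      Real.exp (-(Cw (n + 1) * (∏ j, V j) * (W + Real.log (2 * V (Fin.last n))) *
          Real.log (2 * V (Fin.last n)) / Real.log 2 ^ (n + 2))) <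
        |∑ j, (b j : ℝ) * Real.log (α j : ℝ)|)
    {C₁ : ℝ} (hC₁1 : 1 ≤ C₁)
    (hC₁ : ∀ S : Finset ℕ, (∀ p ∈ S, p.Prime) →
      ∏ p ∈ S, 2 * K * max 1 (Real.log p) ≤ C₁ * (∏ p ∈ S, (p : ℝ)) ^ (1 / 48 : ℝ))
    (h : IsABCTriple a b c) (hab : a ≤ b) (h1 : 1 < a * b) (hac2 : (a : ℝ) ^ 2 < c) :
    Real.log c ≤ 1800 * max 1 (max (max (Cw 2) (Cw 3)) (Cw 4)) *
      (Real.log 6 + Real.log K + 2 * Real.log C₁ + 8) ^ 2 * K * C₁ ^ 2 *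
      (rad a b c : ℝ) ^ (7 / 24 : ℝ) * max 1 (Real.log (rad a b c : ℕ)) ^ 6 *
      Real.log (max (Real.exp 1) (2 * Real.log c)) ^ 3 := by
  classical
  obtain ⟨ha, hb, habc, hcop⟩ := id h
  have hc : c ≠ 0 := by omega
  have hbc : b.Coprime c := coprime_right_of_isABCTriple h
  have hcb : c.Coprime b := hbc.symm
  have hac : a.Coprime c := coprime_left_of_isABCTriple h
  have habc0 : a * b * c ≠ 0 := by positivity
  have hK0 : 0 ≤ K := zero_le_one.trans hK
  have ha_r : (0 : ℝ) < a := by exact_mod_cast ha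
  have hb_r : (0 : ℝ) < b := by exact_mod_cast hb
  have hc_r : (0 : ℝ) < c := by exact_mod_cast Nat.pos_of_ne_zero hc
  have hbc_lt : (b : ℝ) < c := by exact_mod_cast (show b < c by omega)
  have hab_r : (a : ℝ) ≤ b := by exact_mod_cast hab
  -- notation
  set R : ℕ := rad a b c with hRdef
  have hR0n : R ≠ 0 := by
    rw [hRdef, rad_def]; exact UniqueFactorizationMonoid.radical_ne_zero
  have hR1 : (1 : ℝ) ≤ (R : ℝ) := one_le_rad_real a b c
  have hR0 : (0 : ℝ) < R := by linarith
  set Λ : ℝ := max 1 (Real.log (R : ℝ)) with hΛdef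
  have hΛ1 : 1 ≤ Λ := le_max_left _ _
  have hΛ0 : 0 < Λ := by linarith
  set τ : ℝ := (R : ℝ) ^ (1 / 4 : ℝ) with hτdef
  have hτ1 : 1 ≤ τ := Real.one_le_rpow hR1 (by norm_num)
  set y : ℝ := Real.log c with hydef
  have hy0 : 0 < y := Real.log_pos (by exact_mod_cast (show 1 < c by omega))
  set Y : ℝ := Real.log (max (Real.exp 1) (2 * Real.log c)) with hYdef
  have hY1 : 1 ≤ Y := one_le_log_max_exp _
  set Cmax : ℝ := max (max (Cw 2) (Cw 3)) (Cw 4) with hCmax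
  set C' : ℝ := max 1 Cmax with hC'
  have hC'1 : 1 ≤ C' := le_max_left _ _
  have hCle : ∀ n, 2 ≤ n → n ≤ 4 → Cw n ≤ C' := fun n hn2 hn4 => by
    rw [hC', hCmax]; exact apply_le_max_four Cw hn2 hn4
  set D : ℝ := Real.log 6 + Real.log K + 2 * Real.log C₁ + 8 with hDdef
  have hD1 : 1 ≤ D := by
    have h6 : 0 ≤ Real.log 6 := Real.log_nonneg (by norm_num)
    have hK' : 0 ≤ Real.log K := Real.log_nonneg hK
    have hC₁' : 0 ≤ Real.log C₁ := Real.log_nonneg hC₁1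
    rw [hDdef]; linarith
  set J : ℝ := ∏ q ∈ (a * b * c).primeFactors, 2 * K * max 1 (Real.log q) with hJdef
  have hJ1 : 1 ≤ J := one_le_prod_two_mul_max hK _
  have hΘab : theta K a b 0 ≤ K * J :=
    theta_zero_le_mul_prod hK ha.ne' hb.ne' hcop habc0 (Dvd.intro c rfl)
  have hΘac : theta K a c 0 ≤ K * J :=
    theta_zero_le_mul_prod hK ha.ne' hc hac habc0 (Dvd.intro b (by ring))
  have hΘab0 : 0 ≤ theta K a b 0 := theta_nonneg hK0 a b 0
  have hΘac0 : 0 ≤ theta K a c 0 := theta_nonneg hK0 a c 0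
  -- `J ≤ C₁ R^{1/48}`
  have hJle : J ≤ C₁ * (R : ℝ) ^ (1 / 48 : ℝ) := by
    have h1' := hC₁ (a * b * c).primeFactors fun q hq => Nat.prime_of_mem_primeFactors hq
    have hprod : ∏ q ∈ (a * b * c).primeFactors, (q : ℝ) = R := by
      rw [hRdef, rad_def, Nat.radical_eq_prod_primeFactors, Nat.cast_prod]
    rwa [hprod] at h1'
  -- primes of `cb`, small and large
  set P : Finset ℕ := (c * b).primeFactors with hPdef
  have hcbdvd : c * b ∣ a * b * c := Dvd.intro_left a (by ring)
  have hPsub : P ⊆ (a * b * c).primeFactors := Nat.primeFactors_mono hcbdvd habc0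
  have hPprime : ∀ q ∈ P, q.Prime := fun q hq => Nat.prime_of_mem_primeFactors hq
  have hcardP : (P.card : ℝ) ≤ J :=
    le_trans (by exact_mod_cast Finset.card_le_card hPsub) (card_primeFactors_le_prod hK _)
  set S : Finset ℕ := P.filter (fun q => (q : ℝ) ≤ τ) with hSdef
  set L : Finset ℕ := P.filter (fun q => ¬(q : ℝ) ≤ τ) with hLdef
  have hSsub : S ⊆ P := Finset.filter_subset _ _
  have hLsub : L ⊆ P := Finset.filter_subset _ _
  have hSτ : ∀ q ∈ S, (q : ℝ) ≤ τ := fun q hq => (Finset.mem_filter.mp hq).2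
  have hLτ : ∀ q ∈ L, τ < q := fun q hq => lt_of_not_ge (Finset.mem_filter.mp hq).2
  have hLprime : ∀ q ∈ L, q.Prime := fun q hq => hPprime q (hLsub hq)
  have hcardS : (S.card : ℝ) ≤ J :=
    le_trans (by exact_mod_cast Finset.card_le_card hSsub) hcardP
  -- at most three large primes
  have hL3 : L.card ≤ 3 := by
    refine card_le_three_of_quarter_lt hR0n L ?_ hLτ
    have h1' : ∏ q ∈ L, q ∣ ∏ q ∈ (a * b * c).primeFactors, q :=
      Finset.prod_dvd_prod_of_subset _ _ _ (hLsub.trans hPsub)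
    rwa [← Nat.radical_eq_prod_primeFactors, ← rad_def] at h1'
  -- `log q ≤ Λ` on `P`
  have hlogP : ∀ q ∈ P, Real.log q ≤ Λ := by
    intro q hq
    have hqp := hPprime q hq
    have hqR : (q : ℝ) ≤ R := by
      exact_mod_cast prime_le_rad hqp ((Nat.dvd_of_mem_primeFactors hq).trans hcbdvd) habc0
    exact (Real.log_le_log (by exact_mod_cast hqp.pos) hqR).trans (le_max_right _ _)
  -- the smooth part `β` and the splitting of `c/b`
  set e : ℕ → ℤ := expDiff c b with hedef
  set β : ℚ := ∏ q ∈ S, (q : ℚ) ^ e q with hβdef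
  have hβpos : 0 < β := Finset.prod_pos fun q hq =>
    zpow_pos (by exact_mod_cast (hPprime q (hSsub hq)).pos) _
  have hsplitQ : (c : ℚ) / b = β * ∏ q ∈ L, (q : ℚ) ^ e q := by
    rw [cast_div_eq_prod_zpow hc hb.ne' hcb, hβdef, hSdef, hLdef,
      Finset.prod_filter_mul_prod_filter_not]
  set Λ₀ : ℝ := Real.log c - Real.log b with hΛ₀def
  have hΛ₀eq : Λ₀ = Real.log (β : ℝ) + ∑ q ∈ L, (e q : ℝ) * Real.log q := by
    have hcast : (((c : ℚ) / b : ℚ) : ℝ) = (c : ℝ) / b := by push_cast; rfl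
    have hq0 : ∀ q ∈ L, ((q : ℝ)) ^ e q ≠ 0 := fun q hq =>
      zpow_ne_zero _ (by exact_mod_cast (hLprime q hq).ne_zero)
    have h2 : (((c : ℚ) / b : ℚ) : ℝ) = (β : ℝ) * ∏ q ∈ L, (q : ℝ) ^ e q := by
      rw [hsplitQ]; push_cast; rfl
    have hβr : (β : ℝ) ≠ 0 := by exact_mod_cast hβpos.ne'
    have hprod0 : ∏ q ∈ L, (q : ℝ) ^ e q ≠ 0 := Finset.prod_ne_zero_iff.mpr hq0
    calc Λ₀ = Real.log ((c : ℝ) / b) := (Real.log_div hc_r.ne' hb_r.ne').symm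
      _ = Real.log ((β : ℝ) * ∏ q ∈ L, (q : ℝ) ^ e q) := by rw [← hcast, h2]
      _ = Real.log (β : ℝ) + ∑ q ∈ L, Real.log ((q : ℝ) ^ e q) := by
          rw [Real.log_mul hβr hprod0, Real.log_prod hq0]
      _ = Real.log (β : ℝ) + ∑ q ∈ L, (e q : ℝ) * Real.log q := by
          congr 1
          exact Finset.sum_congr rfl fun q _ => Real.log_zpow _ _
  -- `0 < Λ₀ ≤ a/b ≤ 1`
  have hΛ₀pos : 0 < Λ₀ := by
    rw [hΛ₀def]; linarith only [Real.log_lt_log hb_r hbc_lt]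
  have hΛ₀le : Λ₀ ≤ (a : ℝ) / b := by
    have h1' : Real.log ((c : ℝ) / b) ≤ (c : ℝ) / b - 1 := Real.log_le_sub_one_of_pos (by positivity)
    have h2 : (c : ℝ) / b - 1 = (a : ℝ) / b := by
      have : (c : ℝ) = a + b := by exact_mod_cast habc.symm
      rw [this, add_div, div_self hb_r.ne']; ring
    rw [hΛ₀def, ← Real.log_div hc_r.ne' hb_r.ne']
    linarith only [h1', h2]
  have hab1 : (a : ℝ) / b ≤ 1 := (div_le_one hb_r).mpr hab_r
  -- `y < 2 + 2 · (−log Λ₀)`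
  have hstar : y < 2 + 2 * (-Real.log Λ₀) := by
    have h2a : 2 * Real.log a < y := by
      have h' : Real.log ((a : ℝ) ^ 2) < Real.log c := Real.log_lt_log (by positivity) hac2
      have h'' : Real.log ((a : ℝ) ^ 2) = 2 * Real.log a := by
        rw [Real.log_pow]; push_cast; ring
      rw [hydef]; linarith only [h', h'']
    have hlogΛ₀ : Real.log Λ₀ ≤ Real.log a - Real.log b := by
      rw [← Real.log_div ha_r.ne' hb_r.ne']
      exact Real.log_le_log hΛ₀pos hΛ₀le
    have hΛ₀1 : Λ₀ ≤ 1 := hΛ₀le.trans hab1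
    have hyΛ : y - Real.log a = Λ₀ + (Real.log b - Real.log a) := by rw [hΛ₀def]; ring
    linarith only [h2a, hlogΛ₀, hΛ₀1, hyΛ]
  -- exponents: `|e_q| ≤ 1 + 3y`
  set Bₑ : ℝ := 1 + 3 * y with hBₑdef
  have hBₑ1 : 1 ≤ Bₑ := by rw [hBₑdef]; linarith
  have hBₑ : ∀ q ∈ L, (|e q| : ℝ) ≤ Bₑ := by
    intro q hq
    have hqp := hLprime q hq
    have hnat : (|e q| : ℝ) = ((expDiff c b q).natAbs : ℝ) := by
      rw [Nat.cast_natAbs, Int.cast_abs]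
    rw [hnat, natAbs_expDiff hc hb.ne' hcb q]
    have h1' := factorization_le_log (mul_ne_zero hc hb.ne') hqp
    have h2 : Real.log ((c * b : ℕ) : ℝ) ≤ 2 * y := by
      push_cast
      rw [Real.log_mul hc_r.ne' hb_r.ne', hydef]
      linarith only [Real.log_le_log hb_r hbc_lt.le]
    have h3 : (0 : ℝ) ≤ y := hy0.le
    rw [hBₑdef]; linarith only [h1', h2, h3]
  have hlogBₑ : Real.log (Real.exp 1 * Bₑ) ≤ 4 * Y := by
    rw [hBₑdef, hYdef]; exact log_exp_mul_le_four_mul hy0.le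
  have he2 : (2 : ℝ) ≤ Real.exp 1 := by have := Real.add_one_le_exp (1 : ℝ); linarith
  have hlogBₑ0 : 0 ≤ Real.log (Real.exp 1 * Bₑ) :=
    Real.log_nonneg (one_le_mul_of_one_le_of_one_le (by linarith) hBₑ1)
  -- `(log 2)^{-(k+2)} ≤ 32`, `(log 2)^{-(k+1)} ≤ 16` for `k ≤ 3`
  have hlog2 : 0 < Real.log 2 := Real.log_pos one_lt_two
  have hinv : ∀ k, k ≤ 3 → 1 / Real.log 2 ^ (k + 2) ≤ 32 := fun k hk => by
    calc 1 / Real.log 2 ^ (k + 2) ≤ 2 ^ (k + 2) := inv_log_two_pow_le _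
      _ ≤ 2 ^ 5 := pow_le_pow_right₀ (by norm_num) (by omega)
      _ = 32 := by norm_num
  have hinv' : ∀ k, k ≤ 3 → 1 / Real.log 2 ^ (k + 1) ≤ 16 := fun k hk => by
    calc 1 / Real.log 2 ^ (k + 1) ≤ 2 ^ (k + 1) := inv_log_two_pow_le _
      _ ≤ 2 ^ 4 := pow_le_pow_right₀ (by norm_num) (by omega)
      _ = 16 := by norm_num
  have hlog2Λ : Real.log (2 * Λ) ≤ 2 * Λ := log_two_mul_le hΛ1
  have hlog2Λ0 : 0 ≤ Real.log (2 * Λ) := Real.log_nonneg (by linarith)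
  have hΛpow : ∀ k, k ≤ 3 → Λ ^ k ≤ Λ ^ 3 := fun k hk => pow_le_pow_right₀ hΛ1 hk
  -- the target of all cases
  set Pₘ : ℝ := C' * D ^ 2 * K * J ^ 2 * τ * Λ ^ 6 with hPₘ
  set M : ℝ := 1800 * Pₘ with hMdef
  have hMeq : 1800 * (C' * D ^ 2 * K * J ^ 2 * τ * Λ ^ 6) * Y ^ 3 = M * Y ^ 3 := by rw [hMdef]
  have hyM : y ≤ M * Y ^ 3 := by
    rcases Finset.eq_empty_or_nonempty L with hLe | hLne
    · -- every prime of `cb` is small: bound `log c` through the primes of `c` directly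
      have hsmall : ∀ q ∈ c.primeFactors, (q : ℝ) ≤ τ := by
        intro q hq
        have hqP : q ∈ P := Nat.primeFactors_mono (Dvd.intro b rfl) (mul_ne_zero hc hb.ne') hq
        by_contra hqτ
        have : q ∈ L := Finset.mem_filter.mpr ⟨hqP, hqτ⟩
        rw [hLe] at this
        exact Finset.notMem_empty q this
      have h1' := log_le_of_primes_le hK hP2 h h1 hsmall
      have hsubc : c.primeFactors ⊆ (a * b * c).primeFactors :=
        Nat.primeFactors_mono (Dvd.intro_left (a * b) rfl) habc0
      have hcardc : (c.primeFactors.card : ℝ) ≤ J :=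
        le_trans (by exact_mod_cast Finset.card_le_card hsubc) (card_primeFactors_le_prod hK _)
      obtain ⟨-, hA2, -, -, -⟩ := regimeIIK_arith₃ (Hs := 1 + 6 * K * J ^ 2 * τ * Y) hC'1 hD1 hK
        hJ1 hτ1 hΛ1 hY1 le_rfl
      calc y ≤ c.primeFactors.card * (theta K a b 0 * (3 * τ * Y)) := h1'
        _ ≤ J * (K * J * (3 * τ * Y)) := by
            apply mul_le_mul hcardc _ (by positivity) (zero_le_one.trans hJ1)
            exact mul_le_mul_of_nonneg_right hΘab (by positivity)
        _ = 3 * (K * J ^ 2 * τ) * Y := by ring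
        _ ≤ 1800 * (C' * D ^ 2 * K * J ^ 2 * τ * Λ ^ 6) * Y ^ 3 := hA2
        _ = M * Y ^ 3 := hMeq
    · rcases eq_or_ne β 1 with hβ1 | hβ1
      · -- `Λ₀ = ∑_{q ∈ L} e_q log q`
        have hΛ₀eq' : Λ₀ = ∑ q ∈ L, (e q : ℝ) * Real.log q := by
          rw [hΛ₀eq, hβ1]; push_cast; rw [Real.log_one, zero_add]
        rcases le_or_gt 2 L.card with hL2 | hL2
        · have hne : ∑ q ∈ L, (e q : ℝ) * Real.log q ≠ 0 := by rw [← hΛ₀eq']; exact hΛ₀pos.ne'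
          have key := kummer_arch_lower_bound_primes₃ Cw hW₃ L hLprime (by omega) e hΛ1
            (fun q hq => hlogP q (hLsub hq)) hBₑ1 hBₑ hne
          rw [← hΛ₀eq', abs_of_pos hΛ₀pos] at key
          -- `−log Λ₀ < Cw(#L) Λ^{#L} (log(eBₑ) + log 2Λ) log 2Λ / (log 2)^{#L+1} ≤ 192 C' Λ⁵ Y`
          have hCn : Cw L.card ≤ C' := hCle _ hL2 (by omega)
          have hCn0 : 0 ≤ Cw L.card := hCw _
          have hneg : -Real.log Λ₀ ≤ 192 * C' * Λ ^ 5 * Y := by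
            have hsum : Real.log (Real.exp 1 * Bₑ) + Real.log (2 * Λ) ≤ 6 * Λ * Y := by
              have h1' : 2 * Λ ≤ 2 * Λ * Y := le_mul_of_one_le_right (by linarith) hY1
              have h2' : Y ≤ Λ * Y := le_mul_of_one_le_left (by linarith) hΛ1
              have h3' : 6 * Λ * Y = 2 * Λ * Y + 4 * (Λ * Y) := by ring
              linarith only [h1', h2', h3', hlogBₑ, hlog2Λ]
            have hsum0 : 0 ≤ Real.log (Real.exp 1 * Bₑ) + Real.log (2 * Λ) := by linarith
            have h' : Cw L.card * Λ ^ L.card * (Real.log (Real.exp 1 * Bₑ) + Real.log (2 * Λ)) *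
                Real.log (2 * Λ) / Real.log 2 ^ (L.card + 1) ≤
                C' * Λ ^ 3 * (6 * Λ * Y) * (2 * Λ) * 16 := by
              rw [div_eq_mul_one_div]
              apply mul_le_mul _ (hinv' _ hL3) (by positivity) (by positivity)
              apply mul_le_mul _ hlog2Λ hlog2Λ0 (by positivity)
              exact mul_le_mul (mul_le_mul hCn (hΛpow _ hL3) (by positivity) (by positivity))
                hsum hsum0 (by positivity)
            have h'' : C' * Λ ^ 3 * (6 * Λ * Y) * (2 * Λ) * 16 = 192 * C' * Λ ^ 5 * Y := by ring
            linarith only [h', h'', key]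
          obtain ⟨-, -, -, hA4, -⟩ := regimeIIK_arith₃ (Hs := 1 + 6 * K * J ^ 2 * τ * Y) hC'1 hD1
            hK hJ1 hτ1 hΛ1 hY1 le_rfl
          calc y ≤ 2 + 2 * (192 * C' * Λ ^ 5 * Y) := by linarith only [hstar, hneg]
            _ ≤ 1800 * (C' * D ^ 2 * K * J ^ 2 * τ * Λ ^ 6) * Y ^ 3 := hA4
            _ = M * Y ^ 3 := hMeq
        · -- exactly one large prime and `β = 1`: `Λ₀ = e log q₀ ≥ 1/2`
          have hL1 : L.card = 1 := by have := hLne.card_pos; omega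
          obtain ⟨q₀, hLq₀⟩ := Finset.card_eq_one.mp hL1
          have hq₀L : q₀ ∈ L := by rw [hLq₀]; exact Finset.mem_singleton_self q₀
          have hq₀p := hLprime q₀ hq₀L
          have hΛ₀q : Λ₀ = (e q₀ : ℝ) * Real.log q₀ := by rw [hΛ₀eq', hLq₀, Finset.sum_singleton]
          have hlogq₀ : Real.log 2 ≤ Real.log q₀ :=
            Real.log_le_log two_pos (by exact_mod_cast hq₀p.two_le)
          have hlog2' : (1 / 2 : ℝ) < Real.log 2 := by have := Real.log_two_gt_d9; linarith
          have hlogq₀0 : 0 < Real.log q₀ := by linarith only [hlogq₀, hlog2']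
          have he1 : (1 : ℝ) ≤ e q₀ := by
            have hpos : (0 : ℝ) < e q₀ := by
              by_contra hle
              push Not at hle
              have h' : Λ₀ ≤ 0 := by rw [hΛ₀q]; exact mul_nonpos_of_nonpos_of_nonneg hle hlogq₀0.le
              linarith only [h', hΛ₀pos]
            exact_mod_cast (show (1 : ℤ) ≤ e q₀ by exact_mod_cast hpos)
          have hΛ₀ge : 1 / 2 ≤ Λ₀ := by
            rw [hΛ₀q]
            calc (1 / 2 : ℝ) ≤ 1 * Real.log q₀ := by linarith only [hlogq₀, hlog2']
              _ ≤ (e q₀ : ℝ) * Real.log q₀ := mul_le_mul_of_nonneg_right he1 hlogq₀0.le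
          have hneg : -Real.log Λ₀ ≤ 1 := by
            have h' : Real.log (1 / 2) ≤ Real.log Λ₀ := Real.log_le_log (by norm_num) hΛ₀ge
            have h12 : Real.log (1 / 2) = -Real.log 2 := by
              rw [one_div, Real.log_inv]
            have h2 := Real.log_two_lt_d9
            linarith only [h', h12, h2]
          obtain ⟨-, -, hA3, -, -⟩ := regimeIIK_arith₃ (Hs := 1 + 6 * K * J ^ 2 * τ * Y) hC'1 hD1
            hK hJ1 hτ1 hΛ1 hY1 le_rfl
          calc y ≤ 4 := by linarith only [hstar, hneg]
            _ ≤ 1800 * (C' * D ^ 2 * K * J ^ 2 * τ * Λ ^ 6) * Y ^ 3 := hA3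
            _ = M * Y ^ 3 := hMeq
      · -- `β ≠ 1`: the archimedean bound with generators `L ∪ {β₀}`, `β = β₀^{2ʲ}`
        obtain ⟨β₀, j, hβ₀pos, hβ₀1, hβ₀sq, hββ₀⟩ := exists_eq_pow_two_pow_of_pos hβpos hβ1
        -- `log β = 2ʲ log β₀`
        have hlogβ : Real.log (β : ℝ) = ((2 ^ j : ℕ) : ℤ) * Real.log (β₀ : ℝ) := by
          rw [hββ₀, Rat.cast_pow, Real.log_pow]; push_cast; ring
        have hne : ((2 ^ j : ℕ) : ℤ) * Real.log (β₀ : ℝ) + ∑ q ∈ L, (e q : ℝ) * Real.log q ≠ 0 := by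
          have : (((2 ^ j : ℕ) : ℤ) : ℝ) * Real.log (β₀ : ℝ) = Real.log (β : ℝ) := by
            rw [hlogβ]
          rw [this, ← hΛ₀eq]; exact hΛ₀pos.ne'
        -- `β₀` is a unit at the large primes
        have hν : ∀ p ∈ L, padicValRat p β₀ = 0 := by
          intro p hp
          have hpp : p.Prime := hLprime p hp
          haveI : Fact p.Prime := ⟨hpp⟩
          have hpS : p ∉ S := fun hpS => (not_le.mpr (hLτ p hp)) (hSτ p hpS)
          have hvβ : padicValRat p β = 0 := by
            rw [hβdef, padicValRat_finset_prod p S _ (fun q hq =>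
              zpow_ne_zero _ (by exact_mod_cast (hPprime q (hSsub hq)).ne_zero))]
            refine Finset.sum_eq_zero fun q hq => ?_
            have hqp : q.Prime := hPprime q (hSsub hq)
            haveI : Fact q.Prime := ⟨hqp⟩
            have hpq : p ≠ q := fun h => hpS (h ▸ hq)
            rw [padicValRat.zpow, padicValRat.of_nat, padicValNat_primes hpq]
            simp
          rw [hββ₀, padicValRat.pow] at hvβ
          rcases mul_eq_zero.mp hvβ with h0 | h0
          · exact absurd h0 (by positivity)
          · exact h0
        -- heights: `h(β₀) ≤ h(β) ≤ 6 K J² τ Y`, `2ʲ ≤ 2 h(β)`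
        set Hs : ℝ := max 1 (logHeight₁ β) with hHsdef
        have hHs1 : 1 ≤ Hs := le_max_left _ _
        have hhβ := logHeight₁_smooth_le hK hP2 h h1 S hSsub hSτ
        have h6 : logHeight₁ β ≤ 6 * K * J ^ 2 * τ * Y := by
          calc logHeight₁ β ≤ S.card * ((theta K a b 0 + theta K a c 0) * (3 * τ * Y)) := hhβ
            _ ≤ J * ((K * J + K * J) * (3 * τ * Y)) := by
                apply mul_le_mul hcardS _ (by positivity) (zero_le_one.trans hJ1)
                exact mul_le_mul_of_nonneg_right (add_le_add hΘab hΘac) (by positivity)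
            _ = 6 * K * J ^ 2 * τ * Y := by ring
        have h60 : 0 ≤ 6 * K * J ^ 2 * τ * Y := by positivity
        have hh0 : 0 ≤ logHeight₁ β := zero_le_logHeight₁ _
        have hHsle : Hs ≤ 1 + 6 * K * J ^ 2 * τ * Y :=
          max_le (by linarith only [h60]) (by linarith only [h6, hh0])
        have hββ₀h : logHeight₁ β = (2 ^ j : ℕ) * logHeight₁ β₀ := by
          rw [hββ₀, logHeight₁_pow]
        have hh₀pos : Real.log 2 ≤ logHeight₁ β₀ := log_two_le_logHeight₁ hβ₀pos hβ₀1
        have hlog2' : (1 / 2 : ℝ) < Real.log 2 := by have := Real.log_two_gt_d9; linarith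
        have h2j : ((2 ^ j : ℕ) : ℝ) ≤ 2 * logHeight₁ β := by
          rw [hββ₀h]
          have : (0 : ℝ) ≤ (2 ^ j : ℕ) := by positivity
          nlinarith
        have hh₀le : logHeight₁ β₀ ≤ logHeight₁ β := by
          rw [hββ₀h]
          have h1' : (1 : ℝ) ≤ (2 ^ j : ℕ) := by exact_mod_cast Nat.one_le_two_pow
          have : 0 ≤ logHeight₁ β₀ := zero_le_logHeight₁ _
          nlinarith
        -- the coefficients bound `B = Bₑ (1 + 2 h(β))`
        set B : ℝ := Bₑ * (1 + 2 * logHeight₁ β) with hBdef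
        have hB1' : 1 ≤ 1 + 2 * logHeight₁ β := by linarith
        have hB1 : 1 ≤ B := one_le_mul_of_one_le_of_one_le hBₑ1 hB1'
        have hBₑB : Bₑ ≤ B := le_mul_of_one_le_right (by linarith) hB1'
        have hBe : ∀ p ∈ L, (|e p| : ℝ) ≤ B := fun p hp => (hBₑ p hp).trans hBₑB
        have hBm : (|((2 ^ j : ℕ) : ℤ)| : ℝ) ≤ B := by
          have : (|((2 ^ j : ℕ) : ℤ)| : ℝ) = ((2 ^ j : ℕ) : ℝ) := by push_cast; exact abs_of_nonneg (by positivity)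
          rw [this]
          calc ((2 ^ j : ℕ) : ℝ) ≤ 1 + 2 * logHeight₁ β := by linarith
            _ = 1 * (1 + 2 * logHeight₁ β) := (one_mul _).symm
            _ ≤ Bₑ * (1 + 2 * logHeight₁ β) := mul_le_mul_of_nonneg_right hBₑ1 (by linarith)
        have key := kummer_arch_lower_bound₃ Cw hW₃ L hLprime e hβ₀pos hβ₀1 hβ₀sq hν
          ((2 ^ j : ℕ) : ℤ) hΛ1 (fun q hq => hlogP q (hLsub hq)) hB1 hBe hBm hne
        have hΛ₀eq'' : Λ₀ = (((2 ^ j : ℕ) : ℤ) : ℝ) * Real.log (β₀ : ℝ) +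
            ∑ q ∈ L, (e q : ℝ) * Real.log q := by rw [hΛ₀eq, hlogβ]
        rw [← hΛ₀eq'', abs_of_pos hΛ₀pos] at key
        have hL2 : 2 ≤ L.card + 1 := by have := hLne.card_pos; omega
        have hCn : Cw (L.card + 1) ≤ C' := hCle _ hL2 (by omega)
        have hCn0 : 0 ≤ Cw (L.card + 1) := hCw _
        -- the pieces: `H = max(h(β₀), Λ) ≤ Λ Hs`, the logarithms `≤ D Λ Y`
        set H : ℝ := max (logHeight₁ β₀) Λ with hHdef
        have hH1 : 1 ≤ H := hΛ1.trans (le_max_right _ _)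
        have hHle : H ≤ Λ * Hs := by
          refine max_le ?_ (le_mul_of_one_le_right hΛ0.le hHs1)
          calc logHeight₁ β₀ ≤ logHeight₁ β := hh₀le
            _ ≤ Hs := le_max_right _ _
            _ = 1 * Hs := (one_mul _).symm
            _ ≤ Λ * Hs := mul_le_mul_of_nonneg_right hΛ1 (by linarith)
        have hHle' : H ≤ Λ * (1 + 6 * K * J ^ 2 * τ * Y) :=
          hHle.trans (mul_le_mul_of_nonneg_left hHsle hΛ0.le)
        obtain ⟨hlogB, hlogH⟩ := regimeIIK_logs (h := logHeight₁ β) hK hJ1 hC₁1 hR1 rfl hJle rfl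
          hY1 hy0.le hlogBₑ hh0 h6
        have hlogB' : Real.log (Real.exp 1 * B) ≤ D * Λ * Y := by rw [hBdef, hBₑdef]; exact hlogB
        have hlog2H : Real.log (2 * H) ≤ D * Λ * Y := by
          have : Real.log (2 * H) ≤ Real.log (2 * (Λ * (1 + 6 * K * J ^ 2 * τ * Y))) :=
            Real.log_le_log (by linarith) (by linarith)
          exact this.trans hlogH
        have hsum : Real.log (Real.exp 1 * B) + Real.log (2 * H) ≤ 2 * D * Λ * Y := by linarith
        have hsum0 : 0 ≤ Real.log (Real.exp 1 * B) + Real.log (2 * H) := by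
          have h1' : 0 ≤ Real.log (Real.exp 1 * B) :=
            Real.log_nonneg (one_le_mul_of_one_le_of_one_le (by linarith) hB1)
          have h2' : 0 ≤ Real.log (2 * H) := Real.log_nonneg (by linarith)
          linarith
        have hlog2H0 : 0 ≤ Real.log (2 * H) := Real.log_nonneg (by linarith)
        have hneg : -Real.log Λ₀ ≤ 64 * C' * D ^ 2 * Λ ^ 6 * Hs * Y ^ 2 := by
          have h' : Cw (L.card + 1) * (Λ ^ L.card * H) *
              (Real.log (Real.exp 1 * B) + Real.log (2 * H)) * Real.log (2 * H) /
              Real.log 2 ^ (L.card + 2) ≤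
              C' * (Λ ^ 3 * (Λ * Hs)) * (2 * D * Λ * Y) * (D * Λ * Y) * 32 := by
            rw [div_eq_mul_one_div]
            apply mul_le_mul _ (hinv _ hL3) (by positivity) (by positivity)
            apply mul_le_mul _ hlog2H hlog2H0 (by positivity)
            apply mul_le_mul _ hsum hsum0 (by positivity)
            exact mul_le_mul hCn (mul_le_mul (hΛpow _ hL3) hHle (by positivity) (by positivity))
              (by positivity) (by positivity)
          have h'' : C' * (Λ ^ 3 * (Λ * Hs)) * (2 * D * Λ * Y) * (D * Λ * Y) * 32 =
              64 * C' * D ^ 2 * Λ ^ 6 * Hs * Y ^ 2 := by ring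
          linarith only [h', h'', key]
        obtain ⟨-, -, -, -, hA5⟩ := regimeIIK_arith₃ hC'1 hD1 hK hJ1 hτ1 hΛ1 hY1 hHsle
        calc y ≤ 2 + 2 * (64 * C' * D ^ 2 * Λ ^ 6 * Hs * Y ^ 2) := by linarith only [hstar, hneg]
          _ ≤ 1800 * (C' * D ^ 2 * K * J ^ 2 * τ * Λ ^ 6) * Y ^ 3 := hA5
          _ = M * Y ^ 3 := hMeq
  -- absorb `J² τ ≤ C₁² R^{7/24}`
  have hJ2τ : J ^ 2 * τ ≤ C₁ ^ 2 * (R : ℝ) ^ (7 / 24 : ℝ) := by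
    have h48 : ((R : ℝ) ^ (1 / 48 : ℝ)) ^ 2 * (R : ℝ) ^ (1 / 4 : ℝ) = (R : ℝ) ^ (7 / 24 : ℝ) := by
      rw [← Real.rpow_mul_natCast hR0.le, ← Real.rpow_add hR0]; norm_num
    calc J ^ 2 * τ ≤ (C₁ * (R : ℝ) ^ (1 / 48 : ℝ)) ^ 2 * τ :=
          mul_le_mul_of_nonneg_right (pow_le_pow_left₀ (zero_le_one.trans hJ1) hJle 2)
            (zero_le_one.trans hτ1)
      _ = C₁ ^ 2 * (((R : ℝ) ^ (1 / 48 : ℝ)) ^ 2 * (R : ℝ) ^ (1 / 4 : ℝ)) := by rw [hτdef]; ring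
      _ = C₁ ^ 2 * (R : ℝ) ^ (7 / 24 : ℝ) := by rw [h48]
  have hD0 : 0 ≤ D := zero_le_one.trans hD1
  calc y ≤ M * Y ^ 3 := hyM
    _ = 1800 * C' * D ^ 2 * K * (J ^ 2 * τ) * Λ ^ 6 * Y ^ 3 := by rw [hMdef, hPₘ]; ring
    _ ≤ 1800 * C' * D ^ 2 * K * (C₁ ^ 2 * (R : ℝ) ^ (7 / 24 : ℝ)) * Λ ^ 6 * Y ^ 3 := by
        apply mul_le_mul_of_nonneg_right _ (by positivity)
        apply mul_le_mul_of_nonneg_right _ (by positivity)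
        exact mul_le_mul_of_nonneg_left hJ2τ (by positivity)
    _ = 1800 * max 1 (max (max (Cw 2) (Cw 3)) (Cw 4)) *
          (Real.log 6 + Real.log K + 2 * Real.log C₁ + 8) ^ 2 * K * C₁ ^ 2 *
          (rad a b c : ℝ) ^ (7 / 24 : ℝ) * max 1 (Real.log (rad a b c : ℕ)) ^ 6 * Y ^ 3 := by
        rw [hC', hCmax, hDdef, hΛdef, hRdef]; ring

end RegimeTwoKummerSymm

/-! ### Endgame with `Λ⁶ Y³` and assembly -/

section AssemblyKummerSymm

variable {K : ℝ}

/-- **Self-improvement, cubic version:** if `M ≥ 1` and `y ≤ M · (log max{e, 2y})³` then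
`y ≤ 8M (log(432M))³`. [folklore] -/
theorem le_of_le_mul_log_max_cube {y M : ℝ} (hM : 1 ≤ M)
    (h : y ≤ M * Real.log (max (Real.exp 1) (2 * y)) ^ 3) :
    y ≤ 8 * M * Real.log (432 * M) ^ 3 := by
  have hM0 : 0 < M := by linarith
  have hlog : 1 ≤ Real.log (432 * M) := by
    rw [Real.le_log_iff_exp_le (by positivity)]
    have he : Real.exp 1 < 3 := by
      have := Real.exp_one_lt_d9; linarith
    nlinarith
  by_cases hy : 2 * y ≤ Real.exp 1
  · rw [max_eq_left hy, Real.log_exp, one_pow, mul_one] at h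
    calc y ≤ M := h
      _ = 1 * M * 1 := by ring
      _ ≤ 8 * M * Real.log (432 * M) ^ 3 := by
          apply mul_le_mul _ _ zero_le_one (by positivity)
          · linarith
          · exact one_le_pow₀ hlog
  · push Not at hy
    have hy0 : 0 < y := by linarith [Real.exp_pos 1]
    rw [max_eq_right hy.le] at h
    set Y := Real.log (2 * y) with hYdef
    have hY1 : 1 < Y := by
      rw [hYdef, Real.lt_log_iff_exp_lt (by linarith)]; exact hy
    -- `Y ≤ 6 (2y)^{1/6}`, so `Y³ ≤ 216 (2y)^{1/2}`
    have hYle : Y ≤ 6 * (2 * y) ^ (1 / 6 : ℝ) := by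
      have := Real.log_le_rpow_div (show (0 : ℝ) ≤ 2 * y by linarith) (show (0 : ℝ) < 1 / 6 by norm_num)
      rw [hYdef]; linarith [show (2 * y) ^ (1 / 6 : ℝ) / (1 / 6) = 6 * (2 * y) ^ (1 / 6 : ℝ) by ring]
    have hcb : ((2 * y) ^ (1 / 6 : ℝ)) ^ 3 = (2 * y) ^ (1 / 2 : ℝ) := by
      rw [← Real.rpow_mul_natCast (by linarith)]; norm_num
    have hY3 : Y ^ 3 ≤ 216 * (2 * y) ^ (1 / 2 : ℝ) := by
      calc Y ^ 3 ≤ (6 * (2 * y) ^ (1 / 6 : ℝ)) ^ 3 := pow_le_pow_left₀ (by linarith) hYle 3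
        _ = 216 * (2 * y) ^ (1 / 2 : ℝ) := by rw [mul_pow, hcb]; norm_num
    -- hence `y ≤ 216 M (2y)^{1/2}` and `y ≤ 93312 M²`
    have h1 : y ≤ 216 * M * (2 * y) ^ (1 / 2 : ℝ) := by
      calc y ≤ M * Y ^ 3 := h
        _ ≤ M * (216 * (2 * y) ^ (1 / 2 : ℝ)) := mul_le_mul_of_nonneg_left hY3 hM0.le
        _ = 216 * M * (2 * y) ^ (1 / 2 : ℝ) := by ring
    have hhalf : ((2 * y) ^ (1 / 2 : ℝ)) ^ 2 = 2 * y := by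
      rw [← Real.rpow_mul_natCast (by linarith)]; norm_num
    have h2 : y ^ 2 ≤ (216 * M) ^ 2 * (2 * y) := by
      calc y ^ 2 ≤ (216 * M * (2 * y) ^ (1 / 2 : ℝ)) ^ 2 := pow_le_pow_left₀ hy0.le h1 2
        _ = (216 * M) ^ 2 * (2 * y) := by rw [mul_pow, hhalf]
    have h3 : y ≤ 93312 * M ^ 2 := by nlinarith
    -- so `Y ≤ 2 log(432M)` and `y ≤ M Y³ ≤ 8M log(432M)³`
    have hYle' : Y ≤ 2 * Real.log (432 * M) := by
      rw [hYdef, ← Real.log_rpow (by positivity), Real.rpow_two]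
      exact Real.log_le_log (by linarith) (by nlinarith)
    have hY0 : 0 ≤ Y := by linarith
    calc y ≤ M * Y ^ 3 := h
      _ ≤ M * (2 * Real.log (432 * M)) ^ 3 :=
          mul_le_mul_of_nonneg_left (pow_le_pow_left₀ hY0 hYle' 3) hM0.le
      _ = 8 * M * Real.log (432 * M) ^ 3 := by ring

/-- **Endgame of the second regime, `Λ⁶ Y³` version** (pure analysis): if `R ≥ 2`, `M₀ ≥ 1` and
`y ≤ M₀ R^{7/24} Λ⁶ Y³` with `Λ = max(1, log R)`, `Y = log max{e, 2y}`, then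
`y ≤ 64·240⁶ · M₀ (log(432M₀) + 7)³ · R^{1/3} (log R)³`. [folklore] -/
theorem regimeII_endgame9 {y R M₀ : ℝ} (hM₀ : 1 ≤ M₀) (hR : 2 ≤ R)
    (h : y ≤ M₀ * R ^ (7 / 24 : ℝ) * max 1 (Real.log R) ^ 6 *
      Real.log (max (Real.exp 1) (2 * y)) ^ 3) :
    y ≤ 64 * 240 ^ 6 * M₀ * (Real.log (432 * M₀) + 7) ^ 3 * R ^ (1 / 3 : ℝ) * Real.log R ^ 3 := by
  set L : ℝ := Real.log R with hL
  set Λ : ℝ := max 1 L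
  set M : ℝ := M₀ * R ^ (7 / 24 : ℝ) * Λ ^ 6 with hM
  set c₀ : ℝ := Real.log (432 * M₀) with hc₀
  have hR0 : 0 < R := by linarith
  have hR1 : 1 ≤ R := by linarith
  have hΛ1 : 1 ≤ Λ := le_max_left _ _
  have hΛ0 : 0 < Λ := by linarith
  have hR724 : 1 ≤ R ^ (7 / 24 : ℝ) := Real.one_le_rpow hR1 (by norm_num)
  have hM1 : 1 ≤ M := by
    calc (1 : ℝ) = 1 * 1 * 1 := by ring
      _ ≤ M₀ * R ^ (7 / 24 : ℝ) * Λ ^ 6 :=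
          mul_le_mul (mul_le_mul hM₀ hR724 zero_le_one (by linarith)) (one_le_pow₀ hΛ1)
            zero_le_one (by positivity)
  have h1 : y ≤ 8 * M * Real.log (432 * M) ^ 3 :=
    le_of_le_mul_log_max_cube hM1 (by rw [hM]; linarith)
  -- `log(432M) ≤ (c₀ + 7) Λ`
  have hc₀1 : 1 ≤ c₀ := by
    rw [hc₀, Real.le_log_iff_exp_le (by positivity)]
    have := Real.exp_one_lt_d9; nlinarith
  have hlogM : Real.log (432 * M) ≤ (c₀ + 7) * Λ := by
    have hsplit : 432 * M = (432 * M₀) * (R ^ (7 / 24 : ℝ) * Λ ^ 6) := by rw [hM]; ring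
    have hexp : Real.log (432 * M) = c₀ + 7 / 24 * L + 6 * Real.log Λ := by
      rw [hsplit, Real.log_mul (by positivity) (by positivity),
        Real.log_mul (x := R ^ (7 / 24 : ℝ)) (y := Λ ^ 6) (by positivity) (by positivity),
        Real.log_rpow hR0, Real.log_pow, hc₀]
      push_cast; ring
    have hlogΛ : Real.log Λ ≤ Λ := Real.log_le_self hΛ0.le
    have hLΛ : L ≤ Λ := le_max_right _ _
    have hc₀Λ : c₀ ≤ c₀ * Λ := le_mul_of_one_le_right (by linarith) hΛ1
    rw [hexp]; nlinarith
  -- `Λ ≤ 240 R^{1/240}` and `Λ ≤ 2 L`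
  have hΛ240 : Λ ≤ 240 * R ^ (1 / 240 : ℝ) := by
    refine max_le ?_ ?_
    · have : 1 ≤ R ^ (1 / 240 : ℝ) := Real.one_le_rpow hR1 (by norm_num)
      linarith
    · have := Real.log_le_rpow_div hR0.le (show (0 : ℝ) < 1 / 240 by norm_num)
      rw [hL]; linarith [show R ^ (1 / 240 : ℝ) / (1 / 240) = 240 * R ^ (1 / 240 : ℝ) by ring]
  have hL2 : Real.log 2 ≤ L := Real.log_le_log two_pos hR
  have hlog2 : (1 / 2 : ℝ) ≤ Real.log 2 := by have := Real.log_two_gt_d9; linarith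
  have hL0 : 0 ≤ L := by linarith
  have hΛL : Λ ≤ 2 * L := max_le (by linarith) (by linarith)
  have hΛ6 : Λ ^ 6 ≤ 240 ^ 6 * R ^ (1 / 24 : ℝ) := by
    have h6 : (R ^ (1 / 240 : ℝ)) ^ 6 = R ^ (1 / 40 : ℝ) := by
      rw [← Real.rpow_mul_natCast hR0.le]; norm_num
    have h40 : R ^ (1 / 40 : ℝ) ≤ R ^ (1 / 24 : ℝ) :=
      Real.rpow_le_rpow_of_exponent_le hR1 (by norm_num)
    calc Λ ^ 6 ≤ (240 * R ^ (1 / 240 : ℝ)) ^ 6 := pow_le_pow_left₀ hΛ0.le hΛ240 6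
      _ = 240 ^ 6 * R ^ (1 / 40 : ℝ) := by rw [mul_pow, h6]
      _ ≤ 240 ^ 6 * R ^ (1 / 24 : ℝ) := mul_le_mul_of_nonneg_left h40 (by positivity)
  have hΛ3 : Λ ^ 3 ≤ 8 * L ^ 3 := by
    calc Λ ^ 3 ≤ (2 * L) ^ 3 := pow_le_pow_left₀ hΛ0.le hΛL 3
      _ = 8 * L ^ 3 := by ring
  have hRR : R ^ (7 / 24 : ℝ) * R ^ (1 / 24 : ℝ) = R ^ (1 / 3 : ℝ) := by
    rw [← Real.rpow_add hR0]; norm_num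
  -- assemble
  have hc7 : 0 ≤ c₀ + 7 := by linarith
  calc y ≤ 8 * M * Real.log (432 * M) ^ 3 := h1
    _ ≤ 8 * M * ((c₀ + 7) * Λ) ^ 3 := by
        apply mul_le_mul_of_nonneg_left _ (by positivity)
        exact pow_le_pow_left₀ (by linarith [Real.log_nonneg (show (1:ℝ) ≤ 432 * M by linarith)]) hlogM 3
    _ = 8 * M₀ * (c₀ + 7) ^ 3 * R ^ (7 / 24 : ℝ) * Λ ^ 3 * Λ ^ 6 := by rw [hM]; ring
    _ ≤ 8 * M₀ * (c₀ + 7) ^ 3 * R ^ (7 / 24 : ℝ) * (8 * L ^ 3) * (240 ^ 6 * R ^ (1 / 24 : ℝ)) := by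
        apply mul_le_mul _ hΛ6 (by positivity) (by positivity)
        exact mul_le_mul_of_nonneg_left hΛ3 (by positivity)
    _ = 64 * 240 ^ 6 * M₀ * (c₀ + 7) ^ 3 * (R ^ (7 / 24 : ℝ) * R ^ (1 / 24 : ℝ)) * L ^ 3 := by ring
    _ = 64 * 240 ^ 6 * M₀ * (c₀ + 7) ^ 3 * R ^ (1 / 3 : ℝ) * L ^ 3 := by rw [hRR]

/-- **Stewart–Yu's `(1/3, 3)` from the `p`-adic clause and the SYMMETRIC `E = 2` form `hW₃` of a
Kummer-conditional archimedean bound with an arbitrary constant** (the shape of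
Cijsouw–Waldschmidt 1977, Prop. 1 over `ℚ`). Proof as for `…₂`, through `log_le_of_sq_lt_kummer₃`
(`Y³`) and `regimeII_endgame9`. [cite: StewartYu2001, Theorem 1]
[cite: CijsouwWaldschmidt1977, Prop 1 (p. 183)] [cite: Waldschmidt1980, Prop 3.8 (p. 274)] -/
theorem bakerShapeBound_third_three_of_padicClause_kummerArchBound₃ (hK : 1 ≤ K)
    (hP2 : ∀ (ι : Type) [Fintype ι], 0 < Fintype.card ι →
      ∀ ξ : ι → ℚ, (∀ i, ξ i ≠ 0 ∧ ξ i ≠ 1 ∧ ξ i ≠ -1) →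
      ∀ ζ : ℚ, (ζ = 1 ∨ ζ = -1) → ∀ b : ι → ℤ, ζ * ∏ i, ξ i ^ b i ≠ 1 →
      ∀ p : ℕ, p.Prime →
        (padicValRat p (1 - ζ * ∏ i, ξ i ^ b i) : ℝ) * Real.log p <
          K ^ Fintype.card ι * (p / Real.log p) *
            Real.log (max (Real.exp 1) (p * logHeight₁ (ζ * ∏ i, ξ i ^ b i))) *
            ∏ i, logHeight₁ (ξ i))
    (Cw : ℕ → ℝ) (hCw : ∀ n, 0 ≤ Cw n)
    (hW₃ : ∀ (n : ℕ) (α : Fin (n + 1) → ℚ) (b : Fin (n + 1) → ℤ) (V : Fin (n + 1) → ℝ) (W : ℝ),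
      (∀ j, 0 < α j ∧ α j ≠ 1) →
      Module.finrank ℚ ↥(IntermediateField.adjoin ℚ
          (Set.range fun j => Real.sqrt (α j : ℝ))) = 2 ^ (n + 1) →
      Monotone V → 1 ≤ V 0 →
      (∀ j, max (logHeight₁ (α j)) |Real.log (α j : ℝ)| ≤ V j) →
      0 < W → (∀ j, logHeight₁ (b j : ℚ) ≤ W) →
      ∑ j, (b j : ℝ) * Real.log (α j : ℝ) ≠ 0 →
      Real.exp (-(Cw (n + 1) * (∏ j, V j) * (W + Real.log (2 * V (Fin.last n))) *
          Real.log (2 * V (Fin.last n)) / Real.log 2 ^ (n + 2))) <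
        |∑ j, (b j : ℝ) * Real.log (α j : ℝ)|) :
    BakerShapeBound (1 / 3) 3 := by
  obtain ⟨Ca, hCa1, hCa⟩ := exists_prod_mul_log_sq_div_le (show (0 : ℝ) ≤ 4 * K ^ 2 by positivity)
  obtain ⟨C₁, hC₁1, hC₁⟩ := exists_prod_two_mul_max_log_le (zero_le_one.trans hK)
  set κ₁ : ℝ := 64 * K ^ 3 * (2 * Ca) * (Real.log (16 * K ^ 3 * (2 * Ca)) + 3) with hκ₁
  set M₀ : ℝ := 1800 * max 1 (max (max (Cw 2) (Cw 3)) (Cw 4)) *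
    (Real.log 6 + Real.log K + 2 * Real.log C₁ + 8) ^ 2 * K * C₁ ^ 2 with hM₀
  set κ₂ : ℝ := 64 * 240 ^ 6 * M₀ * (Real.log (432 * M₀) + 7) ^ 3 with hκ₂
  have hK3 : 1 ≤ K ^ 3 := one_le_pow₀ hK
  have hCa2 : 1 ≤ 2 * Ca := by linarith
  have hc₀0 : 0 ≤ Real.log (16 * K ^ 3 * (2 * Ca)) := Real.log_nonneg (by nlinarith)
  have hκ₁192 : (192 : ℝ) ≤ κ₁ := by
    have h3 : (3 : ℝ) ≤ Real.log (16 * K ^ 3 * (2 * Ca)) + 3 := by linarith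
    calc (192 : ℝ) = 64 * 1 * 1 * 3 := by norm_num
      _ ≤ 64 * K ^ 3 * (2 * Ca) * (Real.log (16 * K ^ 3 * (2 * Ca)) + 3) :=
          mul_le_mul (mul_le_mul (mul_le_mul_of_nonneg_left hK3 (by norm_num)) hCa2 zero_le_one
            (by positivity)) h3 (by norm_num) (by positivity)
  have hD1 : 1 ≤ Real.log 6 + Real.log K + 2 * Real.log C₁ + 8 := by
    have h6 : 0 ≤ Real.log 6 := Real.log_nonneg (by norm_num)
    have hK' : 0 ≤ Real.log K := Real.log_nonneg hK
    have hC₁' : 0 ≤ Real.log C₁ := Real.log_nonneg hC₁1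
    linarith
  have hD1' : 1 ≤ (Real.log 6 + Real.log K + 2 * Real.log C₁ + 8) ^ 2 := one_le_pow₀ hD1
  have hM₀1 : 1 ≤ M₀ := by
    have h1 : (1 : ℝ) ≤ max 1 (max (max (Cw 2) (Cw 3)) (Cw 4)) := le_max_left _ _
    have h2 : (1 : ℝ) ≤ C₁ ^ 2 := one_le_pow₀ hC₁1
    calc (1 : ℝ) ≤ 1800 * 1 * 1 * 1 * 1 := by norm_num
      _ ≤ 1800 * max 1 (max (max (Cw 2) (Cw 3)) (Cw 4)) *
          (Real.log 6 + Real.log K + 2 * Real.log C₁ + 8) ^ 2 * K * C₁ ^ 2 :=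
          mul_le_mul (mul_le_mul (mul_le_mul (mul_le_mul_of_nonneg_left h1 (by norm_num)) hD1'
            zero_le_one (by positivity)) hK zero_le_one (by positivity)) h2 zero_le_one
            (by positivity)
  have hκ₂0 : 0 ≤ κ₂ := by
    have : 0 ≤ M₀ := zero_le_one.trans hM₀1
    have hl : 0 ≤ Real.log (432 * M₀) + 7 := by
      have : 0 ≤ Real.log (432 * M₀) := Real.log_nonneg (by linarith)
      linarith
    positivity
  -- w.l.o.g. `a ≤ b`
  suffices key : ∀ a b c : ℕ, IsABCTriple a b c → a ≤ b →
      Real.log c ≤ max κ₁ κ₂ * (rad a b c : ℝ) ^ (1 / 3 : ℝ) * Real.log (rad a b c : ℕ) ^ 3 by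
    refine ⟨max κ₁ κ₂, fun a b c h => ?_⟩
    rcases le_total a b with hab | hba
    · exact key a b c h hab
    · have := key b a c h.swap hba
      rwa [rad_swap] at this
  intro a b c h hab
  obtain ⟨ha, hb, habc, hcop⟩ := id h
  have hR2 : (2 : ℝ) ≤ (rad a b c : ℝ) := by
    have : 2 ≤ rad a b c := by
      rw [rad_def, Nat.two_le_radical_iff]
      calc 2 ≤ c := by omega
        _ ≤ a * b * c := Nat.le_mul_of_pos_left c (Nat.mul_pos ha hb)
    exact_mod_cast this
  set R : ℝ := ((rad a b c : ℕ) : ℝ) with hR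
  have hlogR : 0 ≤ Real.log R := Real.log_nonneg (by linarith)
  have hRL : 0 ≤ R ^ (1 / 3 : ℝ) * Real.log R ^ 3 := by positivity
  by_cases h1 : 1 < a * b
  · rcases le_or_gt (c : ℝ) ((a : ℝ) ^ 2) with hca | hac2
    · -- first regime: `p`-adic routes only
      have h' := log_le_of_le_sq hK hP2 hCa1 hCa h hab hca
      calc Real.log c ≤ κ₁ * R ^ (1 / 3 : ℝ) * Real.log R ^ 3 := h'
        _ = κ₁ * (R ^ (1 / 3 : ℝ) * Real.log R ^ 3) := by ring
        _ ≤ max κ₁ κ₂ * (R ^ (1 / 3 : ℝ) * Real.log R ^ 3) :=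
            mul_le_mul_of_nonneg_right (le_max_left _ _) hRL
        _ = max κ₁ κ₂ * R ^ (1 / 3 : ℝ) * Real.log R ^ 3 := by ring
    · -- second regime, Kummer version
      have h' := log_le_of_sq_lt_kummer₃ hK hP2 Cw hCw hW₃ hC₁1 hC₁ h hab h1 hac2
      have h'' : Real.log c ≤ M₀ * R ^ (7 / 24 : ℝ) * max 1 (Real.log R) ^ 6 *
          Real.log (max (Real.exp 1) (2 * Real.log c)) ^ 3 := by
        rw [hM₀]; exact h'
      have h3 := regimeII_endgame9 hM₀1 hR2 h''
      calc Real.log c ≤ κ₂ * R ^ (1 / 3 : ℝ) * Real.log R ^ 3 := by rw [hκ₂]; exact h3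
        _ = κ₂ * (R ^ (1 / 3 : ℝ) * Real.log R ^ 3) := by ring
        _ ≤ max κ₁ κ₂ * (R ^ (1 / 3 : ℝ) * Real.log R ^ 3) :=
            mul_le_mul_of_nonneg_right (le_max_right _ _) hRL
        _ = max κ₁ κ₂ * R ^ (1 / 3 : ℝ) * Real.log R ^ 3 := by ring
  · -- the triple `1 + 1 = 2`
    have hab1 : a * b = 1 := by
      have : 1 ≤ a * b := Nat.mul_pos ha hb
      omega
    have ha1 : a = 1 := Nat.eq_one_of_mul_eq_one_right hab1
    have hb1 : b = 1 := Nat.eq_one_of_mul_eq_one_left hab1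
    have hc2 : c = 2 := by omega
    have hκ : (192 : ℝ) ≤ max κ₁ κ₂ := hκ₁192.trans (le_max_left _ _)
    have hR13 : 1 ≤ R ^ (1 / 3 : ℝ) := Real.one_le_rpow (by linarith) (by norm_num)
    have hL : (0.69 : ℝ) ≤ Real.log R :=
      le_trans (by have := Real.log_two_gt_d9; linarith) (Real.log_le_log two_pos hR2)
    have hL3 : (0.69 : ℝ) ^ 3 ≤ Real.log R ^ 3 := pow_le_pow_left₀ (by norm_num) hL 3
    have hlog2 : Real.log 2 ≤ 0.7 := by have := Real.log_two_lt_d9; linarith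
    calc Real.log c = Real.log 2 := by rw [hc2]; norm_num
      _ ≤ 0.7 := hlog2
      _ ≤ 192 * 1 * (0.69 : ℝ) ^ 3 := by norm_num
      _ ≤ max κ₁ κ₂ * R ^ (1 / 3 : ℝ) * Real.log R ^ 3 :=
          mul_le_mul (mul_le_mul hκ hR13 zero_le_one (by linarith)) hL3 (by norm_num)
            (by positivity)

/-! ### The symmetric `E = 2` form of the assembly (the `…₃` theorems)

What Cijsouw–Waldschmidt's Proposition 1 over `ℚ` (`p = 2`) will discharge: the archimedean
hypothesis `hW₃` with the LARGEST `V` in both logarithmic factors. -/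

/-- **`BakerMethodBounds` from the `p`-adic clause (constant `K ≥ 1`) and the symmetric `E = 2` form
`hW₃` of a Kummer-conditional archimedean bound with an arbitrary constant.**
[cite: StewartYu2001, Theorem 1] [cite: CijsouwWaldschmidt1977, Prop 1 (p. 183)] -/
theorem BakerMethodBounds_of_padicClause_kummerArchBound₃ (hK : 1 ≤ K)
    (hP2 : ∀ (ι : Type) [Fintype ι], 0 < Fintype.card ι →
      ∀ ξ : ι → ℚ, (∀ i, ξ i ≠ 0 ∧ ξ i ≠ 1 ∧ ξ i ≠ -1) →
      ∀ ζ : ℚ, (ζ = 1 ∨ ζ = -1) → ∀ b : ι → ℤ, ζ * ∏ i, ξ i ^ b i ≠ 1 →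
      ∀ p : ℕ, p.Prime →
        (padicValRat p (1 - ζ * ∏ i, ξ i ^ b i) : ℝ) * Real.log p <
          K ^ Fintype.card ι * (p / Real.log p) *
            Real.log (max (Real.exp 1) (p * logHeight₁ (ζ * ∏ i, ξ i ^ b i))) *
            ∏ i, logHeight₁ (ξ i))
    (Cw : ℕ → ℝ) (hCw : ∀ n, 0 ≤ Cw n)
    (hW₃ : ∀ (n : ℕ) (α : Fin (n + 1) → ℚ) (b : Fin (n + 1) → ℤ) (V : Fin (n + 1) → ℝ) (W : ℝ),
      (∀ j, 0 < α j ∧ α j ≠ 1) →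
      Module.finrank ℚ ↥(IntermediateField.adjoin ℚ
          (Set.range fun j => Real.sqrt (α j : ℝ))) = 2 ^ (n + 1) →
      Monotone V → 1 ≤ V 0 →
      (∀ j, max (logHeight₁ (α j)) |Real.log (α j : ℝ)| ≤ V j) →
      0 < W → (∀ j, logHeight₁ (b j : ℚ) ≤ W) →
      ∑ j, (b j : ℝ) * Real.log (α j : ℝ) ≠ 0 →
      Real.exp (-(Cw (n + 1) * (∏ j, V j) * (W + Real.log (2 * V (Fin.last n))) *
          Real.log (2 * V (Fin.last n)) / Real.log 2 ^ (n + 2))) <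
        |∑ j, (b j : ℝ) * Real.log (α j : ℝ)|) :
    BakerMethodBounds :=
  bakerShapeBound_third_three_of_padicClause_kummerArchBound₃ hK hP2 Cw hCw hW₃

/-- **`BakerMethodBounds` from Evertse–Győry's Theorem 3.2.8 over `ℚ` at the finite places and
the symmetric `E = 2` form `hW₃`.** [cite: StewartYu2001, Theorem 1]
[cite: EvertseGyory2015, Thm 3.2.8 (p. 62)] [cite: CijsouwWaldschmidt1977, Prop 1 (p. 183)] -/
theorem BakerMethodBounds_of_thm328Finite_kummerArchBound₃
    (h328 : ∀ (ι : Type) [Fintype ι], 0 < Fintype.card ι →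
      ∀ α : ι → ℚ, (∀ i, α i ≠ 0 ∧ α i ≠ 1 ∧ α i ≠ -1) →
      ∀ β : ℚ, β ≠ 0 → ∀ s : ℤ, (s = 1 ∨ s = -1) → ∀ b : ι → ℤ,
        (∏ i, α i ^ b i) * β ^ s - 1 ≠ 0 →
      ∀ B : ℝ, (∀ i, (|b i| : ℝ) ≤ B) →
        2 * Real.exp 1 * 9 ^ (Fintype.card ι + 1) * (∏ i, logHeight₁ (α i)) *
            max (logHeight₁ β) 1 ≤ B →
        ∀ p : ℕ, p.Prime →
          -(egC6 (Fintype.card ι + 1) * (p / Real.log p) * (∏ i, logHeight₁ (α i)) *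
              max (logHeight₁ β) 1 * logStar (B * p / max (logHeight₁ β) 1)) <
            -(padicValRat p ((∏ i, α i ^ b i) * β ^ s - 1) : ℝ) * Real.log p)
    (Cw : ℕ → ℝ) (hCw : ∀ n, 0 ≤ Cw n)
    (hW₃ : ∀ (n : ℕ) (α : Fin (n + 1) → ℚ) (b : Fin (n + 1) → ℤ) (V : Fin (n + 1) → ℝ) (W : ℝ),
      (∀ j, 0 < α j ∧ α j ≠ 1) →
      Module.finrank ℚ ↥(IntermediateField.adjoin ℚ
          (Set.range fun j => Real.sqrt (α j : ℝ))) = 2 ^ (n + 1) →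
      Monotone V → 1 ≤ V 0 →
      (∀ j, max (logHeight₁ (α j)) |Real.log (α j : ℝ)| ≤ V j) →
      0 < W → (∀ j, logHeight₁ (b j : ℚ) ≤ W) →
      ∑ j, (b j : ℝ) * Real.log (α j : ℝ) ≠ 0 →
      Real.exp (-(Cw (n + 1) * (∏ j, V j) * (W + Real.log (2 * V (Fin.last n))) *
          Real.log (2 * V (Fin.last n)) / Real.log 2 ^ (n + 2))) <
        |∑ j, (b j : ℝ) * Real.log (α j : ℝ)|) :
    BakerMethodBounds :=
  BakerMethodBounds_of_padicClause_kummerArchBound₃ one_le_pastenK (padicClause_of_thm328_finite h328)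
    Cw hCw hW₃

/-- **`BakerMethodBounds` from Yu's Theorem 3.2.7 over `ℚ` as printed (the binder `hY` of
`Dioph.thm328_rat_finite_of_yu`, verbatim) and the symmetric `E = 2` form `hW₃` of a
Kummer-conditional archimedean bound with an arbitrary constant** — so that the archimedean input
of the Stewart–Yu bound may be Cijsouw–Waldschmidt 1977, Proposition 1 for `K = ℚ`, `p = 2`
(Baker's method with a `2`-descent and a SINGLE application of the Schwarz lemma per step, no
extrapolation on an increasing set of points, no zero estimate). [cite: StewartYu2001, Theorem 1]
[cite: EvertseGyory2015, Thm 3.2.7 (p. 62)] [cite: CijsouwWaldschmidt1977, Prop 1 (p. 183)] -/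
theorem BakerMethodBounds_of_yu_kummerArchBound₃
    (hY : ∀ (κ : Type) [Fintype κ] [DecidableEq κ], 2 ≤ Fintype.card κ →
      ∀ (α : κ → ℚ) (b : κ → ℤ) (k₀ : κ) (B Bn δ : ℝ) (p : ℕ), p.Prime →
        (∀ k, α k ≠ 0) → b k₀ ≠ 0 →
        (∀ k, b k ≠ 0 → padicValInt p (b k₀) ≤ padicValInt p (b k)) →
        (∀ k, (|b k| : ℝ) ≤ B) → Bn ≤ B → (|b k₀| : ℝ) ≤ Bn →
        ∏ k, α k ^ b k - 1 ≠ 0 → 0 < δ → δ ≤ 1 / 2 →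
        (padicValRat p (∏ k, α k ^ b k - 1) : ℝ) <
          (16 * Real.exp 1) ^ (2 * (Fintype.card κ + 1)) * (Fintype.card κ : ℝ) ^ (3 / 2 : ℝ) *
              Real.log (2 * Fintype.card κ) * Real.log 2 *
            (p / Real.log p ^ 2) *
            max ((∏ k, max (logHeight₁ (α k)) (1 / (16 * Real.exp 1 ^ 2))) *
                  Real.log (Bn * (2 * Real.exp 1 ^ ((Fintype.card κ + 1) *
                      (6 * Fintype.card κ + 5)) * Real.log 2) * (p : ℝ) ^ (Fintype.card κ + 1) *
                    (∏ k ∈ univ.erase k₀, max (logHeight₁ (α k)) (1 / (16 * Real.exp 1 ^ 2))) /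
                    δ))
              (δ * B / (Bn * (2 ^ (2 * Fintype.card κ + 1) * Real.log 2 * Real.log 3 ^ 3))))
    (Cw : ℕ → ℝ) (hCw : ∀ n, 0 ≤ Cw n)
    (hW₃ : ∀ (n : ℕ) (α : Fin (n + 1) → ℚ) (b : Fin (n + 1) → ℤ) (V : Fin (n + 1) → ℝ) (W : ℝ),
      (∀ j, 0 < α j ∧ α j ≠ 1) →
      Module.finrank ℚ ↥(IntermediateField.adjoin ℚ
          (Set.range fun j => Real.sqrt (α j : ℝ))) = 2 ^ (n + 1) →
      Monotone V → 1 ≤ V 0 →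
      (∀ j, max (logHeight₁ (α j)) |Real.log (α j : ℝ)| ≤ V j) →
      0 < W → (∀ j, logHeight₁ (b j : ℚ) ≤ W) →
      ∑ j, (b j : ℝ) * Real.log (α j : ℝ) ≠ 0 →
      Real.exp (-(Cw (n + 1) * (∏ j, V j) * (W + Real.log (2 * V (Fin.last n))) *
          Real.log (2 * V (Fin.last n)) / Real.log 2 ^ (n + 2))) <
        |∑ j, (b j : ℝ) * Real.log (α j : ℝ)|) :
    BakerMethodBounds :=
  BakerMethodBounds_of_thm328Finite_kummerArchBound₃ (thm328_rat_finite_of_yu hY) Cw hCw hW₃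

/-- **`BakerMethodBounds` from a `p`-adic bound of Yu's shape with generic constants
`C₃(n) · 7(n+1)² ≤ C₆(n,1)` and the symmetric `E = 2` form `hW₃`.** [cite: StewartYu2001, Theorem 1]
[cite: EvertseGyory2015, Thm 3.2.7 (p. 62)] [cite: CijsouwWaldschmidt1977, Prop 1 (p. 183)] -/
theorem BakerMethodBounds_of_padicBound_kummerArchBound₃ (C₃ : ℕ → ℝ)
    (hC₃0 : ∀ n, 2 ≤ n → 0 ≤ C₃ n)
    (hC₃le : ∀ n, 2 ≤ n → C₃ n * (7 * ((n : ℝ) + 1) ^ 2) ≤ egC6 n)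
    (hY : ∀ (κ : Type) [Fintype κ] [DecidableEq κ], 2 ≤ Fintype.card κ →
      ∀ (α : κ → ℚ) (b : κ → ℤ) (k₀ : κ) (B Bn δ : ℝ) (p : ℕ), p.Prime →
        (∀ k, α k ≠ 0) → b k₀ ≠ 0 →
        (∀ k, b k ≠ 0 → padicValInt p (b k₀) ≤ padicValInt p (b k)) →
        (∀ k, (|b k| : ℝ) ≤ B) → Bn ≤ B → (|b k₀| : ℝ) ≤ Bn →
        ∏ k, α k ^ b k - 1 ≠ 0 → 0 < δ → δ ≤ 1 / 2 →
        (padicValRat p (∏ k, α k ^ b k - 1) : ℝ) <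
          C₃ (Fintype.card κ) * (p / Real.log p ^ 2) *
            max ((∏ k, max (logHeight₁ (α k)) (1 / (16 * Real.exp 1 ^ 2))) *
                  Real.log (Bn * (2 * Real.exp 1 ^ ((Fintype.card κ + 1) *
                      (6 * Fintype.card κ + 5)) * Real.log 2) * (p : ℝ) ^ (Fintype.card κ + 1) *
                    (∏ k ∈ univ.erase k₀, max (logHeight₁ (α k)) (1 / (16 * Real.exp 1 ^ 2))) /
                    δ))
              (δ * B / (Bn * (2 ^ (2 * Fintype.card κ + 1) * Real.log 2 * Real.log 3 ^ 3))))
    (Cw : ℕ → ℝ) (hCw : ∀ n, 0 ≤ Cw n)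
    (hW₃ : ∀ (n : ℕ) (α : Fin (n + 1) → ℚ) (b : Fin (n + 1) → ℤ) (V : Fin (n + 1) → ℝ) (W : ℝ),
      (∀ j, 0 < α j ∧ α j ≠ 1) →
      Module.finrank ℚ ↥(IntermediateField.adjoin ℚ
          (Set.range fun j => Real.sqrt (α j : ℝ))) = 2 ^ (n + 1) →
      Monotone V → 1 ≤ V 0 →
      (∀ j, max (logHeight₁ (α j)) |Real.log (α j : ℝ)| ≤ V j) →
      0 < W → (∀ j, logHeight₁ (b j : ℚ) ≤ W) →
      ∑ j, (b j : ℝ) * Real.log (α j : ℝ) ≠ 0 →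
      Real.exp (-(Cw (n + 1) * (∏ j, V j) * (W + Real.log (2 * V (Fin.last n))) *
          Real.log (2 * V (Fin.last n)) / Real.log 2 ^ (n + 2))) <
        |∑ j, (b j : ℝ) * Real.log (α j : ℝ)|) :
    BakerMethodBounds :=
  BakerMethodBounds_of_thm328Finite_kummerArchBound₃
    (thm328_rat_finite_of_padicBound C₃ hC₃0 hC₃le hY) Cw hCw hW₃

/-- **Stewart–Yu 2001, Theorem 1 (`Literature.NumberTheory.DiophantineGeometry.stewart_yu`) from
Yu's Theorem 3.2.7 over `ℚ` and the symmetric `E = 2` form `hW₃`.** [cite: StewartYu2001, Theorem 1]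
[cite: CijsouwWaldschmidt1977, Prop 1 (p. 183)] -/
theorem stewart_yu_of_yu_kummerArchBound₃
    (hY : ∀ (κ : Type) [Fintype κ] [DecidableEq κ], 2 ≤ Fintype.card κ →
      ∀ (α : κ → ℚ) (b : κ → ℤ) (k₀ : κ) (B Bn δ : ℝ) (p : ℕ), p.Prime →
        (∀ k, α k ≠ 0) → b k₀ ≠ 0 →
        (∀ k, b k ≠ 0 → padicValInt p (b k₀) ≤ padicValInt p (b k)) →
        (∀ k, (|b k| : ℝ) ≤ B) → Bn ≤ B → (|b k₀| : ℝ) ≤ Bn →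
        ∏ k, α k ^ b k - 1 ≠ 0 → 0 < δ → δ ≤ 1 / 2 →
        (padicValRat p (∏ k, α k ^ b k - 1) : ℝ) <
          (16 * Real.exp 1) ^ (2 * (Fintype.card κ + 1)) * (Fintype.card κ : ℝ) ^ (3 / 2 : ℝ) *
              Real.log (2 * Fintype.card κ) * Real.log 2 *
            (p / Real.log p ^ 2) *
            max ((∏ k, max (logHeight₁ (α k)) (1 / (16 * Real.exp 1 ^ 2))) *
                  Real.log (Bn * (2 * Real.exp 1 ^ ((Fintype.card κ + 1) *
                      (6 * Fintype.card κ + 5)) * Real.log 2) * (p : ℝ) ^ (Fintype.card κ + 1) *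
                    (∏ k ∈ univ.erase k₀, max (logHeight₁ (α k)) (1 / (16 * Real.exp 1 ^ 2))) /
                    δ))
              (δ * B / (Bn * (2 ^ (2 * Fintype.card κ + 1) * Real.log 2 * Real.log 3 ^ 3))))
    (Cw : ℕ → ℝ) (hCw : ∀ n, 0 ≤ Cw n)
    (hW₃ : ∀ (n : ℕ) (α : Fin (n + 1) → ℚ) (b : Fin (n + 1) → ℤ) (V : Fin (n + 1) → ℝ) (W : ℝ),
      (∀ j, 0 < α j ∧ α j ≠ 1) →
      Module.finrank ℚ ↥(IntermediateField.adjoin ℚ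
          (Set.range fun j => Real.sqrt (α j : ℝ))) = 2 ^ (n + 1) →
      Monotone V → 1 ≤ V 0 →
      (∀ j, max (logHeight₁ (α j)) |Real.log (α j : ℝ)| ≤ V j) →
      0 < W → (∀ j, logHeight₁ (b j : ℚ) ≤ W) →
      ∑ j, (b j : ℝ) * Real.log (α j : ℝ) ≠ 0 →
      Real.exp (-(Cw (n + 1) * (∏ j, V j) * (W + Real.log (2 * V (Fin.last n))) *
          Real.log (2 * V (Fin.last n)) / Real.log 2 ^ (n + 2))) <
        |∑ j, (b j : ℝ) * Real.log (α j : ℝ)|) :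
    Literature.NumberTheory.DiophantineGeometry.stewart_yu :=
  BakerMethodBounds_of_yu_kummerArchBound₃ hY Cw hCw hW₃

end AssemblyKummerSymm

end Literature.Barriers.ABC
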